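import Mathlib.Analysis.Convex.Function
import Mathlib.Analysis.Convex.Slope
import Mathlib.Topology.MetricSpace.HausdorffDistance
import Mathlib.MeasureTheory.Integral.IntervalIntegral.FundThmCalculus
import Mathlib.Analysis.Calculus.Deriv.Shift
import Mathlib.Analysis.Calculus.Deriv.Slope
import Mathlib.Analysis.Calculus.Deriv.Pow
import Literature.Geometry.Lorentzian.CausalityOpennessProofs
import Literature.Analysis.Convex.InfDistConvex
import HarnessLib

/-!
# Transitivity of the chronological relation `≪` (O'Neill 1983, Ch. 14, p. 402): corner smoothing

This file discharges the named fact
`Literature.Geometry.Lorentzian.LorentzianMetric.chronologicalFuture_chronologicalFuture_subset` of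
`Literature.Geometry.Lorentzian.Causality`
(`LorentzianMetric.chronologicalFuture_chronologicalFuture_subset_holds`): for every time-oriented
Lorentzian metric `(g, τ)` and every `S ⊆ M`, `I⁺(I⁺(S)) ⊆ I⁺(S)`, i.e. `p ≪ q ≪ r ⟹ p ≪ r` —
O'Neill 1983, Ch. 14, p. 402: "The relations defined above are transitive", with the display
`I⁺(A) = I⁺(I⁺A) = …` on p. 403.

## What had to be proved, and in which generality

O'Neill's timelike curves are piecewise smooth (Ch. 5, p. 146, with `⟨α'(tᵢ⁻), α'(tᵢ⁺)⟩ < 0` at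
breaks), and transitivity is the juxtaposition of curves. The vendored `I⁺`
(`LorentzianMetric.chronologicalFuture`) uses instead maps `γ : ℝ → M` differentiable *at every
parameter of `[a, b]`* (two-sidedly) with future-pointing timelike velocity
(`LorentzianMetric.IsFutureTimelikeCurveOn`, Wald's convention), so the corner of the juxtaposed
curve at the junction point `q` has to be rounded off — for curves which are merely
differentiable (velocities neither continuous nor locally bounded away from the null cone, so no
portion of `γ₁`, `γ₂` may be displaced: only exact pieces of them can be used, joined to new
pieces at single points with matching velocity). Moreover the fact is declared in a `section`
with `variable [FiniteDimensional ℝ E] [T2Space M] [BoundarylessManifold I M]`, none of which is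
used by (hence recorded in) the `def`: it quantifies over manifolds with boundary and corners
modelled on an arbitrary `I : ModelWithCorners ℝ E H` (`range I` closed convex with nonempty
interior, `E` any real normed space). At a junction point `q` on the boundary both curves are
tangent to `range I` in the chart (they are differentiable *at* `q` as maps `ℝ → M ⊆` chart
`⊆ range I`), and the rounded corner has to stay inside `range I`. All of this goes through, so
the fact is proved as declared (no Hausdorff, dimension, completeness or `C²` hypothesis is used
either); `LorentzianMetric.exists_isFutureTimelikeCurveOn_trans` is the pointwise statement.

## Proof

Let `γ₁ : [a₁, b₁] → M` run from `p` to `q`, `γ₂ : [a₂, b₂] → M` from `q` to `r`; `φ` the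
extended chart at `q`, `e_q` the tangent trivialization at `q`, `x₀ = φ q`, `R = range I`.

*Part II (the manifold).*
1. The **chart timecone** `chartTimecone g τ q r₀ ⊆ E × E` (pairs `(z, u)`, `z` in the chart
   target near `x₀`, `e_q⁻¹ u` future-pointing timelike at `φ⁻¹ z`) has convex fibres
   (`chartTimecone_convex`, from `val_convexComb_lt_zero` of
   `Literature.Geometry.Lorentzian.CausalityOpennessProofs`: timecones are convex, O'Neill
   Ch. 5, Lemma 5.29) and is *relatively* open: it agrees over the target with an open
   `O ⊆ E × E` (`exists_isOpen_chartTimecone`, from the openness of the future timecone bundle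
   `isOpen_futureTimecone` and continuity of the chart lift, `continuousOn_chartLift`).
2. Chart curves through the chart timecone lift to future timelike curves also at boundary chart
   points (`chartTimecone_velocity`: chain rule *within* `range I`, Mathlib
   `HasMFDerivWithinAt.comp`, `TangentBundle.symmL_trivializationAt`), and future timelike
   curves read in the chart run through it (`chartTimecone_of_curve`,
   `hasDerivAt_extChartAt_comp`).
3. A curve `c : ℝ → R` differentiable at `t` is tangent to `R` to first order on both sides:
   `infDist (c t ± s c'(t)) R = o(s)` (`tendsto_infDist_div_of_hasDerivAt`).
4. Assembly (`exists_isFutureTimelikeCurveOn_trans`): `v₁ = e_q(γ₁'(b₁))`; `t₂ > a₂` so close to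
   `a₂` that `γ₂ t₂` is in the chart, `y = φ(γ₂ t₂)` is `r/4`-close to `x₀` and the chord
   `d = (y - x₀)/(t₂ - a₂)` is `r/4`-close to `e_q(γ₂'(a₂))` (Mathlib `HasDerivAt.tendsto_slope`),
   where `B(x₀, r) × B(e_q γ₂'(a₂), r) ⊆ O`; `w = e_q(γ₂'(t₂))`. Part I produces a `C¹` chart
   curve `σ : [0, L] → R` from `(x₀, v₁)` to `(y, w)` through `O`. The final curve is `γ₁` on
   `(-∞, b₁]`, `φ⁻¹ ∘ σ(· - b₁)` on `[b₁, b₁ + L]`, `γ₂(· + c)` after; near `[b₁, b₁ + L]` it is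
   `φ⁻¹` of a chart curve glued from `φ ∘ γ₁`, `σ`, `φ ∘ γ₂`, differentiable at the two junctions
   by one-sided gluing; elsewhere it agrees locally with `γ₁` or a translate of `γ₂`
   (`timelike_of_eventuallyEq`).

*Part I (`CornerSmoothing`, calculus in a real normed space `F`;
`CornerSmoothing.exists_cornerCurve_convex`).* Data: `R` closed convex, `closedBall z ρ ⊆ R`,
`O` open, `x₀, y = x₀ + δ d ∈ R`, `B(x₀, r) × B(d, r/2) ⊆ O`, segments `{x₀} × [v₁, d]`,
`{y} × [w, d] ⊆ O`, tangency `e₁(s) = infDist (x₀ + s v₁) R = o(s)`,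
`e₃(s) = infDist (y - s w) R = o(s)`.
* *Base curve* `σb` on `[0, L]`, `L = δ + ε`: the *half curve* `Hc` from `x₀` — corner piece
  `σ₁` (velocity `v₁ → d` linearly on `[0, ε]`), *wiggle* `Wg` on `[ε, ε + δ/8]` (velocity `d`
  minus the bump `(ε/2) B'((s-ε)/T)/T · v₁`, `B(t) = 3t² - 2t³`, cancelling the offset
  `(ε/2) v₁` of the corner piece), straight piece `Sl(s) = x₀ + (s - ε/2) d` — and, reversed in
  time, the half curve from `y` with data `(-w, -d)`; the two agree on the middle affine piece.
  Each position is the midpoint of a point of the segment `[x₀, y] ⊆ R` and of `x₀ + a v₁`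
  (resp. `y - a w`) with `a ≤ 2s` (corner piece) or `a ≤ ε` (wiggle), so by convexity of
  `infDist · R` (`Literature.Analysis.Convex.convexOn_infDist`, shared leaf
  `Literature/Analysis/Convex/InfDistConvex.lean`; the former in-file copies
  `CornerSmoothing.convexOn_infDist`, `convexOn_infDist_line`, `infDist_midpoint_le` are kept as
  deprecated aliases) its distance to `R` is at most `e₁(2s)/2`, `e₁(ε)/2`, `0`
  (`infDist_Hc_le`); velocities stay on the segment `[v₁, d]`, resp. `O(ε/δ)`-close to `d`.
* *Push into `R`*: `γ = (1 - λ) σb + λ z` with `λ(s) = (G₁(θ(s)) + G₃(θ(L - s)))/ρ`, where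
  `Gᵢ(s) = ∫_{4s}^{8s} eᵢ(u)/u du` is a *differentiable majorant* of the convex `o(s)` function
  `eᵢ` (`Gm`: `eᵢ(4s) ≤ Gᵢ(s) ≤ eᵢ(8s)/2`, `|Gᵢ'| ≤ 8 eᵢ(8s)/(8s)`, fundamental theorem of
  calculus, monotonicity of `eᵢ(u)/u` from convexity, `ConvexOn.secant_mono`), and `θ` (`θp`) is
  a `C¹` clamp profile (identity near `0`, saturating at scale `ε`, cut off inside the middle
  piece). A point `p` with `infDist p R ≤ X/2`, `X ≤ λρ`, has `(1 - λ) p + λ z ∈ R`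
  (`pushed_mem`), giving `γ ⊆ R`; `λ, λ' → 0` with `ε`, so `(γ, γ')` stays in the tubes about the
  two segments (`exists_tube_segment`, compactness) and in the product ball, i.e. in `O`
  (`pushed_mem_O`); `λ` vanishes to first order at `0` and `L`, so the endpoint data are kept.

## References

* B. O'Neill, *Semi-Riemannian geometry with applications to relativity*, Academic Press 1983,
  Ch. 5, Lemma 5.29 (p. 143: timecones, "timecones are convex"), p. 146 (timelike curves);
  Ch. 14, p. 402 ("The relations defined above are transitive") and p. 403
  (`I⁺(A) = I⁺(I⁺A) = I⁺(J⁺A) = J⁺(I⁺A) ⊂ J⁺(J⁺A) = J⁺(A)`).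
* R. M. Wald, *General Relativity*, Chicago 1984, §8.1 (differentiable timelike curves).
* R. Penrose, *Techniques of differential topology in relativity*, SIAM 1972, §2 (smoothing the
  corners of trips).
-/

noncomputable section

open Bundle Set Filter Function Metric
open scoped Manifold ContDiff Topology

namespace Literature.Geometry.Lorentzian

/-! ## Part I. A `C¹` corner curve inside a closed convex set (normed-space calculus) -/

namespace CornerSmoothing

variable {F : Type*} [NormedAddCommGroup F] [NormedSpace ℝ F]

/-- Gluing one-sided derivatives at a point. [folklore] -/
theorem hasDerivAt_of_Iic_Ici {f : ℝ → ℝ} {f' : ℝ} {t : ℝ}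
    (h₁ : HasDerivWithinAt f f' (Iic t) t) (h₂ : HasDerivWithinAt f f' (Ici t) t) :
    HasDerivAt f f' t := by
  have := h₁.union h₂
  rwa [Iic_union_Ici, hasDerivWithinAt_univ] at this

/-- Gluing one-sided derivatives at a point (vector-valued). [folklore] -/
theorem hasDerivAt_of_Iic_Ici' {f : ℝ → F} {f' : F} {t : ℝ}
    (h₁ : HasDerivWithinAt f f' (Iic t) t) (h₂ : HasDerivWithinAt f f' (Ici t) t) :
    HasDerivAt f f' t := by
  have := h₁.union h₂
  rwa [Iic_union_Ici, hasDerivWithinAt_univ] at this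

/-! ### Distance to a convex set

The three lemmas of this subsection (the distance to a nonempty convex set is a convex function,
also along a line, and the midpoint estimate) were hoisted verbatim — same statements, same
proofs — to the shared leaf `Literature/Analysis/Convex/InfDistConvex.lean`
(`Literature.Analysis.Convex.convexOn_infDist`, `convexOn_infDist_line`, `infDist_midpoint_le`;
librarian promotion 1141960, item wi-30406, 2026-08-16), which this file now imports and uses.
The old names below are deprecated aliases kept for downstream stability. -/

/-- The distance to a convex set is a convex function — **deprecated alias** of the hoisted
`Literature.Analysis.Convex.convexOn_infDist` (`Analysis/Convex/InfDistConvex.lean`). [folklore] -/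
@[deprecated Literature.Analysis.Convex.convexOn_infDist (since := "2026-08-16")]
alias convexOn_infDist := Literature.Analysis.Convex.convexOn_infDist

/-- The distance to a convex set along a line `s ↦ x₀ + s v` is a convex function of `s` —
**deprecated alias** of the hoisted `Literature.Analysis.Convex.convexOn_infDist_line`
(`Analysis/Convex/InfDistConvex.lean`). [folklore] -/
@[deprecated Literature.Analysis.Convex.convexOn_infDist_line (since := "2026-08-16")]
alias convexOn_infDist_line := Literature.Analysis.Convex.convexOn_infDist_line

/-- Midpoint estimate `infDist ((a + b)/2) R ≤ (infDist a R + infDist b R)/2` for convex `R` —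
**deprecated alias** of the hoisted `Literature.Analysis.Convex.infDist_midpoint_le`
(`Analysis/Convex/InfDistConvex.lean`). [folklore] -/
@[deprecated Literature.Analysis.Convex.infDist_midpoint_le (since := "2026-08-16")]
alias infDist_midpoint_le := Literature.Analysis.Convex.infDist_midpoint_le

/-! ### Pushing towards an interior point -/

/-- **Feasibility by pushing towards an interior ball.** Let `R` be closed and convex and
`closedBall z ρ ⊆ R`. If `infDist p R ≤ X / 2` and `X ≤ t ρ` with `0 ≤ t ≤ 1`, then the point
`(1 - t) p + t z` lies in `R` (for `X = 0` because `p ∈ R`, otherwise because `p` is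
`tρ`-close to a point `π ∈ R` and `(1 - t) p + t z = (1 - t) π + t (z + (1 - t) t⁻¹ (p - π))`).
[folklore] -/
theorem pushed_mem {R : Set F} (hR : Convex ℝ R) (hRc : IsClosed R) {z : F} {ρ : ℝ} (hρ : 0 ≤ ρ)
    (hz : closedBall z ρ ⊆ R) {p : F} {X t : ℝ} (hp : infDist p R ≤ X / 2) (hX : X ≤ t * ρ)
    (ht0 : 0 ≤ t) (ht1 : t ≤ 1) : (1 - t) • p + t • z ∈ R := by
  have hzR : z ∈ R := hz (mem_closedBall_self hρ)
  have hne : R.Nonempty := ⟨z, hzR⟩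
  rcases eq_or_lt_of_le (infDist_nonneg (x := p) (s := R)) with h0 | hpos
  · -- `p ∈ R`
    have hpR : p ∈ R := (hRc.mem_iff_infDist_zero hne).mpr h0.symm
    exact hR hpR hzR (by linarith) ht0 (by ring)
  · -- `0 < infDist p R ≤ X/2 < X ≤ tρ`
    have hXpos : 0 < X := by linarith
    have htpos : 0 < t := by
      rcases ht0.eq_or_lt with rfl | h
      · rw [zero_mul] at hX; linarith
      · exact h
    have hlt : infDist p R < t * ρ := by linarith
    obtain ⟨pR, hpR', hppR⟩ := (infDist_lt_iff hne).mp hlt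
    set q : F := z + ((1 - t) * t⁻¹) • (p - pR) with hq
    have hqR : q ∈ R := by
      refine hz ?_
      rw [mem_closedBall, hq, dist_eq_norm, add_sub_cancel_left, norm_smul, Real.norm_of_nonneg
        (by positivity), ← dist_eq_norm]
      calc (1 - t) * t⁻¹ * dist p pR ≤ 1 * t⁻¹ * (t * ρ) := by
            gcongr
            · linarith
        _ = ρ := by field_simp
    have heq : (1 - t) • p + t • z = (1 - t) • pR + t • q := by
      rw [hq, smul_add, smul_smul, ← mul_assoc, mul_comm t (1 - t), mul_assoc,
        mul_inv_cancel₀ htpos.ne', mul_one, smul_sub]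
      abel
    rw [heq]
    exact hR hpR' hqR (by linarith) ht0 (by ring)

/-! ### A differentiable majorant of a convex `o(s)` defect function -/

section Majorant

variable {e : ℝ → ℝ}

/-- Slopes from the origin of a convex function vanishing at `0` are monotone. [folklore] -/
theorem div_le_div_of_convexOn (hec : ConvexOn ℝ univ e) (he0 : e 0 = 0) {a b : ℝ} (ha : 0 < a)
    (hab : a ≤ b) : e a / a ≤ e b / b := by
  have h := hec.secant_mono (a := 0) (x := a) (y := b) (mem_univ _) (mem_univ _) (mem_univ _)
    ha.ne' (by linarith) hab
  simpa [he0] using h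

/-- A nonnegative convex function vanishing at `0` is monotone on `[0, ∞)`. [folklore] -/
theorem le_of_convexOn (hec : ConvexOn ℝ univ e) (he0 : e 0 = 0) (henn : ∀ s, 0 ≤ e s) {a b : ℝ}
    (ha : 0 ≤ a) (hab : a ≤ b) : e a ≤ e b := by
  rcases ha.eq_or_lt with rfl | ha'
  · rw [he0]; exact henn b
  · have hb : 0 < b := by linarith
    have h := div_le_div_of_convexOn hec he0 ha' hab
    rw [div_le_div_iff₀ ha' hb] at h
    nlinarith [henn b, henn a]

variable (e) in
/-- The slope function `ψ u = e(u)/u` for `u > 0`, extended by `0`. [folklore] -/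
def ψ (u : ℝ) : ℝ := if 0 < u then e u / u else 0

/-- `ψ u = e(u)/u` for `u > 0`. [folklore] -/
theorem ψ_of_pos {u : ℝ} (hu : 0 < u) : ψ e u = e u / u := if_pos hu

/-- `ψ u = 0` for `u ≤ 0`. [folklore] -/
theorem ψ_of_nonpos {u : ℝ} (hu : u ≤ 0) : ψ e u = 0 := if_neg (not_lt.mpr hu)

/-- `u ψ(u) = e(u)` for `u > 0`. [folklore] -/
theorem mul_ψ {u : ℝ} (hu : 0 < u) : u * ψ e u = e u := by
  rw [ψ_of_pos hu, mul_div_cancel₀ _ hu.ne']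

/-- `ψ ≥ 0`. [folklore] -/
theorem ψ_nonneg (henn : ∀ s, 0 ≤ e s) (u : ℝ) : 0 ≤ ψ e u := by
  by_cases hu : 0 < u
  · rw [ψ_of_pos hu]; exact div_nonneg (henn u) hu.le
  · rw [ψ_of_nonpos (not_lt.mp hu)]

/-- `ψ` is monotone on `[0, ∞)`. [folklore] -/
theorem ψ_mono (hec : ConvexOn ℝ univ e) (he0 : e 0 = 0) (henn : ∀ s, 0 ≤ e s) {a b : ℝ}
    (ha : 0 ≤ a) (hab : a ≤ b) : ψ e a ≤ ψ e b := by
  rcases ha.eq_or_lt with rfl | ha'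
  · rw [ψ_of_nonpos le_rfl]; exact ψ_nonneg henn b
  · rw [ψ_of_pos ha', ψ_of_pos (ha'.trans_le hab)]
    exact div_le_div_of_convexOn hec he0 ha' hab

/-- `ψ` is continuous (at `0` because `e(u)/u → 0`). [folklore] -/
theorem continuous_ψ (hecont : Continuous e) (heo : Tendsto (fun s ↦ e s / s) (𝓝[>] 0) (𝓝 0)) :
    Continuous (ψ e) := by
  refine continuous_iff_continuousAt.mpr fun u ↦ ?_
  rcases lt_trichotomy u 0 with hu | rfl | hu
  · -- locally `0`
    have hev : ψ e =ᶠ[𝓝 u] fun _ ↦ 0 := by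
      filter_upwards [Iio_mem_nhds hu] with u' hu'
      exact ψ_of_nonpos (le_of_lt hu')
    exact (continuousAt_const.congr hev.symm)
  · -- at `0`
    have h1 : Tendsto (ψ e) (𝓝[≤] 0) (𝓝 0) := by
      refine tendsto_const_nhds.congr' ?_
      filter_upwards [self_mem_nhdsWithin] with u hu
      exact (ψ_of_nonpos hu).symm
    have h2 : Tendsto (ψ e) (𝓝[>] 0) (𝓝 0) := by
      refine heo.congr' ?_
      filter_upwards [self_mem_nhdsWithin] with u hu
      exact (ψ_of_pos hu).symm
    have key : Tendsto (ψ e) (𝓝[≤] 0 ⊔ 𝓝[>] 0) (𝓝 0) := tendsto_sup.mpr ⟨h1, h2⟩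
    rw [nhdsLE_sup_nhdsGT] at key
    show Tendsto (ψ e) (𝓝 0) (𝓝 (ψ e 0))
    rwa [ψ_of_nonpos le_rfl]
  · -- locally `e u / u`
    have hev : ψ e =ᶠ[𝓝 u] fun u ↦ e u / u := by
      filter_upwards [Ioi_mem_nhds hu] with u' hu'
      exact ψ_of_pos hu'
    refine ContinuousAt.congr ?_ hev.symm
    exact (hecont.continuousAt).div continuousAt_id hu.ne'

variable (e) in
/-- The majorant `G(s) = ∫_{4s}^{8s} ψ`. [folklore] -/
def Gm (s : ℝ) : ℝ := ∫ u in (4 * s)..(8 * s), ψ e u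

variable (e) in
/-- Its derivative `G'(s) = 8 ψ(8s) - 4 ψ(4s)`. [folklore] -/
def Gm' (s : ℝ) : ℝ := 8 * ψ e (8 * s) - 4 * ψ e (4 * s)

/-- `G` is differentiable with derivative `G'` (fundamental theorem of calculus). [folklore] -/
theorem hasDerivAt_Gm (hecont : Continuous e) (heo : Tendsto (fun s ↦ e s / s) (𝓝[>] 0) (𝓝 0))
    (s : ℝ) : HasDerivAt (Gm e) (Gm' e s) s := by
  have hψ := continuous_ψ hecont heo
  have hΨ : ∀ t, HasDerivAt (fun t ↦ ∫ u in (0 : ℝ)..t, ψ e u) (ψ e t) t :=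
    fun t ↦ (hψ.integral_hasStrictDerivAt 0 t).hasDerivAt
  have h8 : HasDerivAt (fun s ↦ ∫ u in (0 : ℝ)..(8 * s), ψ e u) (ψ e (8 * s) * 8) s :=
    (hΨ (8 * s)).comp s ((hasDerivAt_id s).const_mul 8 |>.congr_deriv (by simp))
  have h4 : HasDerivAt (fun s ↦ ∫ u in (0 : ℝ)..(4 * s), ψ e u) (ψ e (4 * s) * 4) s :=
    (hΨ (4 * s)).comp s ((hasDerivAt_id s).const_mul 4 |>.congr_deriv (by simp))
  have hG : Gm e = fun s ↦ (∫ u in (0 : ℝ)..(8 * s), ψ e u) - ∫ u in (0 : ℝ)..(4 * s), ψ e u := by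
    funext s
    rw [Gm, intervalIntegral.integral_interval_sub_left (hψ.intervalIntegrable _ _)
      (hψ.intervalIntegrable _ _)]
  rw [hG]
  refine (h8.sub h4).congr_deriv ?_
  rw [Gm']; ring

/-- `G` vanishes on `(-∞, 0]`. [folklore] -/
theorem Gm_of_nonpos {s : ℝ} (hs : s ≤ 0) : Gm e s = 0 := by
  rw [Gm]
  have : EqOn (ψ e) (fun _ ↦ (0 : ℝ)) (uIcc (4 * s) (8 * s)) := by
    intro u hu
    rw [uIcc_of_ge (by linarith)] at hu
    exact ψ_of_nonpos (by linarith [hu.2])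
  rw [intervalIntegral.integral_congr this, intervalIntegral.integral_zero]

/-- `G'` vanishes on `(-∞, 0]`. [folklore] -/
theorem Gm'_of_nonpos {s : ℝ} (hs : s ≤ 0) : Gm' e s = 0 := by
  rw [Gm', ψ_of_nonpos (by linarith), ψ_of_nonpos (by linarith)]; ring

/-- Lower bound `G(s) ≥ e(4s)` for `s ≥ 0` (monotonicity of `ψ`). [folklore] -/
theorem le_Gm (hec : ConvexOn ℝ univ e) (he0 : e 0 = 0) (henn : ∀ s, 0 ≤ e s)
    (hecont : Continuous e) (heo : Tendsto (fun s ↦ e s / s) (𝓝[>] 0) (𝓝 0)) {s : ℝ}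
    (hs : 0 ≤ s) : e (4 * s) ≤ Gm e s := by
  have hψ := continuous_ψ hecont heo
  rcases hs.eq_or_lt with rfl | hs'
  · simp [Gm, he0]
  · have h1 : ∫ _ in (4 * s)..(8 * s), ψ e (4 * s) ≤ Gm e s := by
      rw [Gm]
      refine intervalIntegral.integral_mono_on (by linarith) (by simp)
        (hψ.intervalIntegrable _ _) fun u hu ↦ ?_
      exact ψ_mono hec he0 henn (by linarith) hu.1
    rw [intervalIntegral.integral_const, smul_eq_mul] at h1
    have h2 : (8 * s - 4 * s) * ψ e (4 * s) = e (4 * s) := by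
      rw [show 8 * s - 4 * s = 4 * s by ring, mul_ψ (by linarith)]
    linarith

/-- Upper bound `G(s) ≤ e(8s)/2` for `s ≥ 0`. [folklore] -/
theorem Gm_le (hec : ConvexOn ℝ univ e) (he0 : e 0 = 0) (henn : ∀ s, 0 ≤ e s)
    (hecont : Continuous e) (heo : Tendsto (fun s ↦ e s / s) (𝓝[>] 0) (𝓝 0)) {s : ℝ}
    (hs : 0 ≤ s) : Gm e s ≤ e (8 * s) / 2 := by
  have hψ := continuous_ψ hecont heo
  rcases hs.eq_or_lt with rfl | hs'
  · simp [Gm, he0]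
  · have h1 : Gm e s ≤ ∫ _ in (4 * s)..(8 * s), ψ e (8 * s) := by
      rw [Gm]
      refine intervalIntegral.integral_mono_on (by linarith) (hψ.intervalIntegrable _ _) (by simp)
        fun u hu ↦ ?_
      exact ψ_mono hec he0 henn (by linarith [hu.1]) hu.2
    rw [intervalIntegral.integral_const, smul_eq_mul] at h1
    have h2 : (8 * s - 4 * s) * ψ e (8 * s) = e (8 * s) / 2 := by
      have := mul_ψ (e := e) (u := 8 * s) (by linarith)
      linear_combination (1 / 2 : ℝ) * this
    linarith

/-- `G ≥ 0`. [folklore] -/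
theorem Gm_nonneg (hec : ConvexOn ℝ univ e) (he0 : e 0 = 0) (henn : ∀ s, 0 ≤ e s)
    (hecont : Continuous e) (heo : Tendsto (fun s ↦ e s / s) (𝓝[>] 0) (𝓝 0)) (s : ℝ) :
    0 ≤ Gm e s := by
  rcases le_or_gt s 0 with hs | hs
  · rw [Gm_of_nonpos hs]
  · exact (henn _).trans (le_Gm hec he0 henn hecont heo hs.le)

/-- Derivative bound `|G'(s)| ≤ 8 ψ(8s)` (and `ψ(8s) ≤ ψ(8c)` for `s ≤ c`). [folklore] -/
theorem abs_Gm'_le (hec : ConvexOn ℝ univ e) (he0 : e 0 = 0) (henn : ∀ s, 0 ≤ e s) {s c : ℝ}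
    (hsc : s ≤ c) : |Gm' e s| ≤ 8 * ψ e (8 * c) := by
  rcases le_or_gt s 0 with hs | hs
  · rw [Gm'_of_nonpos hs, abs_zero]
    have := ψ_nonneg henn (8 * c)
    positivity
  · have h1 : ψ e (4 * s) ≤ ψ e (8 * s) := ψ_mono hec he0 henn (by linarith) (by linarith)
    have h2 : ψ e (8 * s) ≤ ψ e (8 * c) := ψ_mono hec he0 henn (by linarith) (by linarith)
    have h3 := ψ_nonneg henn (4 * s)
    rw [Gm', abs_le]
    constructor <;> linarith

end Majorant

/-! ### The smooth step `B(t) = 3t² - 2t³` -/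

/-- The cubic smooth step. [folklore] -/
def Bst (t : ℝ) : ℝ := 3 * t ^ 2 - 2 * t ^ 3

/-- Its derivative `6t(1 - t)`. [folklore] -/
def Bst' (t : ℝ) : ℝ := 6 * t * (1 - t)

/-- Derivative of the smooth step. [folklore] -/
theorem hasDerivAt_Bst (t : ℝ) : HasDerivAt Bst (Bst' t) t := by
  have h := ((hasDerivAt_pow 2 t).const_mul 3).sub ((hasDerivAt_pow 3 t).const_mul 2)
  refine h.congr_deriv ?_
  simp only [Bst', Nat.cast_ofNat]
  ring

/-- `B(0) = 0`. [folklore] -/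
theorem Bst_zero : Bst 0 = 0 := by simp [Bst]
/-- `B(1) = 1`. [folklore] -/
theorem Bst_one : Bst 1 = 1 := by norm_num [Bst]
/-- `B'(0) = 0`. [folklore] -/
theorem Bst'_zero : Bst' 0 = 0 := by simp [Bst']
/-- `B'(1) = 0`. [folklore] -/
theorem Bst'_one : Bst' 1 = 0 := by simp [Bst']

/-- `B ≥ 0` on `[0, 1]`. [folklore] -/
theorem Bst_nonneg {t : ℝ} (ht : t ∈ Icc (0 : ℝ) 1) : 0 ≤ Bst t := by
  simp only [Bst]; nlinarith [ht.1, ht.2, sq_nonneg t, mul_nonneg ht.1 (sq_nonneg t)]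

/-- `B ≤ 1` on `[0, 1]`. [folklore] -/
theorem Bst_le_one {t : ℝ} (ht : t ∈ Icc (0 : ℝ) 1) : Bst t ≤ 1 := by
  simp only [Bst]
  nlinarith [ht.1, ht.2, sq_nonneg (t - 1), mul_nonneg ht.1 (sq_nonneg (t - 1)),
    mul_nonneg (sub_nonneg.mpr ht.2) (sq_nonneg t)]

/-- `B ≤ 1/2` on `[0, 1/2]`. [folklore] -/
theorem Bst_le_half {t : ℝ} (ht : t ∈ Icc (0 : ℝ) (1 / 2)) : Bst t ≤ 1 / 2 := by
  simp only [Bst]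
  nlinarith [ht.1, ht.2, sq_nonneg t, mul_nonneg ht.1 (sq_nonneg t),
    mul_nonneg ht.1 (mul_nonneg ht.1 (sub_nonneg.mpr ht.2))]

/-- `B' ≥ 0` on `[0, 1]`. [folklore] -/
theorem Bst'_nonneg {t : ℝ} (ht : t ∈ Icc (0 : ℝ) 1) : 0 ≤ Bst' t := by
  simp only [Bst']; nlinarith [ht.1, ht.2]

/-- `B' ≤ 3/2`. [folklore] -/
theorem Bst'_le (t : ℝ) : Bst' t ≤ 3 / 2 := by
  simp only [Bst']; nlinarith [sq_nonneg (t - 1 / 2)]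

/-- `|B'| ≤ 3/2` on `[0, 1]`. [folklore] -/
theorem abs_Bst'_le {t : ℝ} (ht : t ∈ Icc (0 : ℝ) 1) : |Bst' t| ≤ 3 / 2 := by
  rw [abs_of_nonneg (Bst'_nonneg ht)]; exact Bst'_le t

/-! ### The clamp profile `θ` -/

section Clamp

variable {ε ℓ : ℝ}

variable (ε ℓ) in
/-- The clamp profile: identity on `(-∞, ε/2]`, saturating on `[ε/2, ε]` at `3ε/4`, descending
to `0` on `[ε, ε + ℓ]` along the smooth step, `0` after. [folklore] -/
def θp (s : ℝ) : ℝ :=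
  if s ≤ ε / 2 then s
  else if s ≤ ε then s - (s - ε / 2) ^ 2 / ε
  else if s ≤ ε + ℓ then (3 * ε / 4) * (1 - Bst ((s - ε) / ℓ))
  else 0

variable (ε ℓ) in
/-- The derivative of the clamp profile. [folklore] -/
def θp' (s : ℝ) : ℝ :=
  if s ≤ ε / 2 then 1
  else if s ≤ ε then 1 - 2 * (s - ε / 2) / ε
  else if s ≤ ε + ℓ then -(3 * ε / 4) * Bst' ((s - ε) / ℓ) / ℓ
  else 0

/-- The clamp profile is the identity on `(-∞, ε/2]`. [folklore] -/
theorem θp_of_le_half {s : ℝ} (hs : s ≤ ε / 2) : θp ε ℓ s = s := by simp [θp, hs]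

/-- The clamp profile vanishes on `[ε + ℓ, ∞)`. [folklore] -/
theorem θp_of_ge {s : ℝ} (hε : 0 < ε) (hs : ε + ℓ ≤ s) (hℓ : 0 < ℓ) : θp ε ℓ s = 0 := by
  have h1 : ¬ s ≤ ε / 2 := by linarith
  have h2 : ¬ s ≤ ε := by linarith
  rcases hs.eq_or_lt with rfl | hlt
  · simp [θp, h1, h2, Bst_one, div_self hℓ.ne']
  · simp [θp, h1, h2, not_le.mpr hlt]

/-- The clamp profile is differentiable everywhere. [folklore] -/
theorem hasDerivAt_θp (hε : 0 < ε) (hℓ : 0 < ℓ) (s : ℝ) : HasDerivAt (θp ε ℓ) (θp' ε ℓ s) s := by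
  -- the four pieces
  have hp1 : ∀ s, HasDerivAt (fun s : ℝ ↦ s) 1 s := fun s ↦ hasDerivAt_id' s
  have hp2 : ∀ s, HasDerivAt (fun s : ℝ ↦ s - (s - ε / 2) ^ 2 / ε) (1 - 2 * (s - ε / 2) / ε) s := by
    intro s
    have h := (hasDerivAt_id' s).sub ((((hasDerivAt_id' s).sub_const (ε / 2)).pow 2).div_const ε)
    refine h.congr_deriv ?_
    simp only [Nat.cast_ofNat]
    ring
  have hp3 : ∀ s, HasDerivAt (fun s : ℝ ↦ (3 * ε / 4) * (1 - Bst ((s - ε) / ℓ)))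
      (-(3 * ε / 4) * Bst' ((s - ε) / ℓ) / ℓ) s := by
    intro s
    have hin : HasDerivAt (fun s : ℝ ↦ (s - ε) / ℓ) (1 / ℓ) s := by
      simpa using ((hasDerivAt_id' s).sub_const ε).div_const ℓ
    have hB := (hasDerivAt_Bst ((s - ε) / ℓ)).comp s hin
    have h := ((hB.const_sub 1).const_mul (3 * ε / 4))
    refine h.congr_deriv ?_
    ring
  have hp4 : ∀ s, HasDerivAt (fun _ : ℝ ↦ (0 : ℝ)) 0 s := fun s ↦ hasDerivAt_const s 0
  -- case analysis
  rcases lt_trichotomy s (ε / 2) with h1 | rfl | h1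
  · have hev : θp ε ℓ =ᶠ[𝓝 s] fun s ↦ s := by
      filter_upwards [Iio_mem_nhds h1] with s' hs'
      exact θp_of_le_half (le_of_lt hs')
    rw [show θp' ε ℓ s = 1 by simp [θp', h1.le]]
    exact (hp1 s).congr_of_eventuallyEq hev
  · -- junction at ε/2
    rw [show θp' ε ℓ (ε / 2) = 1 by simp [θp']]
    refine hasDerivAt_of_Iic_Ici ?_ ?_
    · exact (hp1 _).hasDerivWithinAt.congr (fun s' hs' ↦ θp_of_le_half hs') (θp_of_le_half le_rfl)
    · have h := (hp2 (ε / 2)).hasDerivWithinAt (s := Ici (ε / 2))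
      rw [show 1 - 2 * (ε / 2 - ε / 2) / ε = 1 by simp] at h
      have hval : θp ε ℓ (ε / 2) = ε / 2 - (ε / 2 - ε / 2) ^ 2 / ε := by
        rw [θp_of_le_half le_rfl]; ring
      refine h.congr_of_eventuallyEq ?_ hval
      filter_upwards [Icc_mem_nhdsGE (show ε / 2 < ε by linarith)] with s' hs'
      rcases hs'.1.eq_or_lt with rfl | hlt
      · exact hval
      · simp [θp, not_le.mpr hlt, hs'.2]
  · rcases lt_trichotomy s ε with h2 | heq | h2
    · have hev : θp ε ℓ =ᶠ[𝓝 s] fun s ↦ s - (s - ε / 2) ^ 2 / ε := by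
        filter_upwards [Ioo_mem_nhds h1 h2] with s' hs'
        simp [θp, not_le.mpr hs'.1, hs'.2.le]
      rw [show θp' ε ℓ s = 1 - 2 * (s - ε / 2) / ε by simp [θp', not_le.mpr h1, h2.le]]
      exact (hp2 s).congr_of_eventuallyEq hev
    · -- junction at ε
      rw [heq] at h1 ⊢
      have hne : ¬ ε ≤ ε / 2 := by linarith
      rw [show θp' ε ℓ ε = 0 by
        simp only [θp', hne, le_refl, if_false, if_true]; field_simp; ring]
      refine hasDerivAt_of_Iic_Ici ?_ ?_
      · have h := (hp2 ε).hasDerivWithinAt (s := Iic ε)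
        rw [show 1 - 2 * (ε - ε / 2) / ε = 0 by field_simp; ring] at h
        refine h.congr_of_eventuallyEq ?_ (by simp [θp, hne])
        filter_upwards [Icc_mem_nhdsLE (show ε / 2 < ε by linarith)] with s' hs'
        rcases hs'.1.eq_or_lt with rfl | hlt
        · rw [θp_of_le_half le_rfl]; ring
        · simp [θp, not_le.mpr hlt, hs'.2]
      · have h := (hp3 ε).hasDerivWithinAt (s := Ici ε)
        rw [show -(3 * ε / 4) * Bst' ((ε - ε) / ℓ) / ℓ = 0 by simp [Bst'_zero]] at h
        have hval : θp ε ℓ ε = (3 * ε / 4) * (1 - Bst ((ε - ε) / ℓ)) := by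
          simp [θp, hne, Bst_zero]; field_simp; ring
        refine h.congr_of_eventuallyEq ?_ hval
        filter_upwards [Icc_mem_nhdsGE (show ε < ε + ℓ by linarith)] with s' hs'
        rcases hs'.1.eq_or_lt with rfl | hlt
        · exact hval
        · have : ¬ s' ≤ ε / 2 := by linarith
          simp [θp, this, not_le.mpr hlt, hs'.2]
    · rcases lt_trichotomy s (ε + ℓ) with h3 | rfl | h3
      · have hev : θp ε ℓ =ᶠ[𝓝 s] fun s ↦ (3 * ε / 4) * (1 - Bst ((s - ε) / ℓ)) := by
          filter_upwards [Ioo_mem_nhds h2 h3] with s' hs'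
          have : ¬ s' ≤ ε / 2 := by linarith [hs'.1]
          simp [θp, this, not_le.mpr hs'.1, hs'.2.le]
        have hne1 : ¬ s ≤ ε / 2 := by linarith
        rw [show θp' ε ℓ s = -(3 * ε / 4) * Bst' ((s - ε) / ℓ) / ℓ by
          simp [θp', hne1, not_le.mpr h2, h3.le]]
        exact (hp3 s).congr_of_eventuallyEq hev
      · -- junction at ε + ℓ
        have hne1 : ¬ ε + ℓ ≤ ε / 2 := by linarith
        have hne2 : ¬ ε + ℓ ≤ ε := by linarith
        rw [show θp' ε ℓ (ε + ℓ) = 0 by simp [θp', hne1, hne2, Bst'_one, div_self hℓ.ne']]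
        refine hasDerivAt_of_Iic_Ici ?_ ?_
        · have h := (hp3 (ε + ℓ)).hasDerivWithinAt (s := Iic (ε + ℓ))
          rw [show -(3 * ε / 4) * Bst' ((ε + ℓ - ε) / ℓ) / ℓ = 0 by
            simp [div_self hℓ.ne', Bst'_one]] at h
          have hval : θp ε ℓ (ε + ℓ) = (3 * ε / 4) * (1 - Bst ((ε + ℓ - ε) / ℓ)) := by
            simp [θp, hne1, hne2, div_self hℓ.ne', Bst_one]
          refine h.congr_of_eventuallyEq ?_ hval
          filter_upwards [Icc_mem_nhdsLE (show ε < ε + ℓ by linarith)] with s' hs'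
          rcases hs'.2.eq_or_lt' with rfl | hlt
          · exact hval
          · rcases hs'.1.eq_or_lt with rfl | hlt'
            · simp [θp, show ¬ ε ≤ ε / 2 by linarith, Bst_zero]; field_simp; ring
            · have : ¬ s' ≤ ε / 2 := by linarith
              simp [θp, this, not_le.mpr hlt', hlt.le]
        · refine (hp4 (ε + ℓ)).hasDerivWithinAt.congr_of_eventuallyEq ?_
            (θp_of_ge hε le_rfl hℓ)
          filter_upwards [self_mem_nhdsWithin] with s' hs'
          exact θp_of_ge hε hs' hℓ
      · have hev : θp ε ℓ =ᶠ[𝓝 s] fun _ ↦ (0 : ℝ) := by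
          filter_upwards [Ioi_mem_nhds h3] with s' hs'
          exact θp_of_ge hε (le_of_lt hs') hℓ
        have hne1 : ¬ s ≤ ε / 2 := by linarith
        have hne2 : ¬ s ≤ ε := by linarith
        rw [show θp' ε ℓ s = 0 by simp [θp', hne1, hne2, not_le.mpr h3]]
        exact (hp4 s).congr_of_eventuallyEq hev

/-- Values of the clamp profile lie in `[0, ε]` on `[0, ∞)`; more precisely in `[0, 3ε/4]`.
[folklore] -/
theorem θp_mem (hε : 0 < ε) (hℓ : 0 < ℓ) {s : ℝ} (hs : 0 ≤ s) : θp ε ℓ s ∈ Icc 0 ε := by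
  by_cases h1 : s ≤ ε / 2
  · rw [θp_of_le_half h1]; exact ⟨hs, by linarith⟩
  · by_cases h2 : s ≤ ε
    · simp only [θp, h1, h2, if_false, if_true]
      have hq : (s - ε / 2) ^ 2 / ε ≤ (s - ε / 2) := by
        rw [div_le_iff₀ hε]; nlinarith
      constructor
      · nlinarith [div_nonneg (sq_nonneg (s - ε / 2)) hε.le]
      · have : 0 ≤ (s - ε / 2) ^ 2 / ε := div_nonneg (sq_nonneg _) hε.le
        nlinarith
    · by_cases h3 : s ≤ ε + ℓ
      · simp only [θp, h1, h2, h3, if_false, if_true]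
        have ht : (s - ε) / ℓ ∈ Icc (0 : ℝ) 1 :=
          ⟨div_nonneg (by linarith) hℓ.le, (div_le_one hℓ).mpr (by linarith)⟩
        have hB0 := Bst_nonneg ht
        have hB1 := Bst_le_one ht
        constructor
        · nlinarith
        · nlinarith
      · rw [θp_of_ge hε (le_of_lt (not_le.mp h3)) hℓ]; exact ⟨le_rfl, hε.le⟩

/-- On `[ε/2, ε + ℓ/2]` the clamp profile is at least `3ε/8`. [folklore] -/
theorem θp_ge (hε : 0 < ε) (hℓ : 0 < ℓ) {s : ℝ} (hs : s ∈ Icc (ε / 2) (ε + ℓ / 2)) :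
    3 * ε / 8 ≤ θp ε ℓ s := by
  by_cases h1 : s ≤ ε / 2
  · rw [θp_of_le_half h1]; linarith [hs.1]
  · by_cases h2 : s ≤ ε
    · simp only [θp, h1, h2, if_false, if_true]
      have : (s - ε / 2) ^ 2 / ε ≤ (s - ε / 2) / 2 := by
        rw [div_le_iff₀ hε]; nlinarith [hs.1]
      nlinarith [hs.1]
    · have h3 : s ≤ ε + ℓ := by linarith [hs.2]
      simp only [θp, h1, h2, h3, if_false, if_true]
      have ht : (s - ε) / ℓ ∈ Icc (0 : ℝ) (1 / 2) :=
        ⟨div_nonneg (by linarith) hℓ.le, by rw [div_le_iff₀ hℓ]; linarith [hs.2]⟩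
      have := Bst_le_half ht
      nlinarith

/-- Derivative bound for the clamp profile. [folklore] -/
theorem abs_θp'_le (hε : 0 < ε) (hℓ : 0 < ℓ) (s : ℝ) : |θp' ε ℓ s| ≤ max 1 (9 * ε / (8 * ℓ)) := by
  by_cases h1 : s ≤ ε / 2
  · simp [θp', h1]
  · by_cases h2 : s ≤ ε
    · simp only [θp', h1, h2, if_false, if_true]
      refine le_trans ?_ (le_max_left _ _)
      have hx0 : 0 ≤ 2 * (s - ε / 2) / ε := div_nonneg (by linarith) hε.le
      have hx1 : 2 * (s - ε / 2) / ε ≤ 1 := by rw [div_le_one hε]; linarith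
      rw [abs_le]
      constructor <;> linarith
    · by_cases h3 : s ≤ ε + ℓ
      · simp only [θp', h1, h2, h3, if_false, if_true]
        refine le_trans ?_ (le_max_right _ _)
        have ht : (s - ε) / ℓ ∈ Icc (0 : ℝ) 1 :=
          ⟨div_nonneg (by linarith) hℓ.le, (div_le_one hℓ).mpr (by linarith)⟩
        have hB := abs_Bst'_le ht
        rw [abs_div, abs_mul, abs_neg, abs_of_pos (by positivity : 0 < 3 * ε / 4), abs_of_pos hℓ,
          div_le_div_iff₀ hℓ (by positivity)]
        nlinarith [mul_le_mul_of_nonneg_left hB (by positivity : (0 : ℝ) ≤ ε * ℓ)]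
      · simp [θp', h1, h2, h3]

end Clamp

/-! ### The pieces of the half curve -/

section Pieces

/-- First piece: leaves `x₀` with velocity `v₁`, velocity turning linearly to `m` over `[0, ε]`.
[folklore] -/
def σ₁ (x₀ v₁ m : F) (ε s : ℝ) : F := x₀ + s • v₁ + (s ^ 2 / (2 * ε)) • (m - v₁)

/-- Velocity of the first piece. [folklore] -/
def σ₁' (v₁ m : F) (ε s : ℝ) : F := v₁ + (s / ε) • (m - v₁)

/-- The wiggle: velocity `d` minus a bump multiple of `v₁` cancelling the offset `(ε/2) v₁`
accumulated by the first piece, over `[ε, ε + T]`. [folklore] -/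
def Wg (x₀ v₁ d : F) (ε T s : ℝ) : F :=
  x₀ + ((ε / 2) * (1 - Bst ((s - ε) / T))) • v₁ + (s - ε / 2) • d

/-- Velocity of the wiggle. [folklore] -/
def Wg' (v₁ d : F) (ε T s : ℝ) : F := d - ((ε / 2) * Bst' ((s - ε) / T) / T) • v₁

/-- The straight piece `x₀ + (s - ε/2) d`. [folklore] -/
def Sl (x₀ d : F) (ε s : ℝ) : F := x₀ + (s - ε / 2) • d

/-- The half curve: first piece, wiggle, straight piece. [folklore] -/
def Hc (x₀ v₁ d : F) (ε T s : ℝ) : F :=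
  if s ≤ ε then σ₁ x₀ v₁ d ε s else if s ≤ ε + T then Wg x₀ v₁ d ε T s else Sl x₀ d ε s

/-- Velocity of the half curve. [folklore] -/
def Hc' (v₁ d : F) (ε T s : ℝ) : F :=
  if s ≤ ε then σ₁' v₁ d ε s else if s ≤ ε + T then Wg' v₁ d ε T s else d

variable {x₀ v₁ m d : F} {ε T : ℝ}

/-- Derivative of the first piece. [folklore] -/
theorem hasDerivAt_σ₁ (hε : ε ≠ 0) (s : ℝ) :
    HasDerivAt (σ₁ x₀ v₁ m ε) (σ₁' v₁ m ε s) s := by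
  have h1 : HasDerivAt (fun s : ℝ ↦ s • v₁) ((1 : ℝ) • v₁) s := (hasDerivAt_id s).smul_const v₁
  have h2 : HasDerivAt (fun s : ℝ ↦ (s ^ 2 / (2 * ε)) • (m - v₁))
      ((↑(2 : ℕ) * s ^ (2 - 1) / (2 * ε)) • (m - v₁)) s :=
    ((hasDerivAt_pow 2 s).div_const (2 * ε)).smul_const (m - v₁)
  have h := (h1.add h2).const_add x₀
  convert h using 1
  · funext s; simp only [σ₁, Pi.add_apply, add_assoc]
  · rw [show ((2 : ℕ) : ℝ) * s ^ (2 - 1) / (2 * ε) = s / ε by norm_num; field_simp, one_smul]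
    rfl

/-- The first piece starts at `x₀`. [folklore] -/
theorem σ₁_zero : σ₁ x₀ v₁ m ε 0 = x₀ := by simp [σ₁]

/-- The first piece starts with velocity `v₁`. [folklore] -/
theorem σ₁'_zero : σ₁' v₁ m ε 0 = v₁ := by simp [σ₁']

/-- The first piece at `ε`. [folklore] -/
theorem σ₁_eps (hε : ε ≠ 0) : σ₁ x₀ v₁ m ε ε = x₀ + (ε / 2) • v₁ + (ε / 2) • m := by
  simp only [σ₁]
  have : ε ^ 2 / (2 * ε) = ε / 2 := by field_simp
  rw [this, smul_sub]
  have hv : ε • v₁ = (ε / 2) • v₁ + (ε / 2) • v₁ := by rw [← add_smul]; ring_nf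
  rw [hv]; abel

/-- The first piece ends with velocity `m`. [folklore] -/
theorem σ₁'_eps (hε : ε ≠ 0) : σ₁' v₁ m ε ε = m := by
  simp [σ₁', div_self hε]

/-- The velocity of the first piece is a convex combination of `v₁` and `m`. [folklore] -/
theorem σ₁'_eq (s : ℝ) : σ₁' v₁ m ε s = (1 - s / ε) • v₁ + (s / ε) • m := by
  simp only [σ₁', smul_sub, sub_smul, one_smul]
  abel

/-- The first piece as a midpoint. [folklore] -/
theorem σ₁_eq_midpoint (s : ℝ) : σ₁ x₀ v₁ m ε s =
    (1 / 2 : ℝ) • (x₀ + (2 * s - s ^ 2 / ε) • v₁) + (1 / 2 : ℝ) • (x₀ + (s ^ 2 / ε) • m) := by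
  simp only [σ₁]
  module

/-- The first piece stays `2ε(‖v₁‖ + ‖m‖)`-close to `x₀`. [folklore] -/
theorem dist_σ₁_le (hε : 0 < ε) {s : ℝ} (hs : s ∈ Icc 0 ε) :
    dist (σ₁ x₀ v₁ m ε s) x₀ ≤ 2 * ε * (‖v₁‖ + ‖m‖) := by
  rw [dist_eq_norm, σ₁, add_assoc, add_sub_cancel_left]
  have h1 : ‖s • v₁‖ ≤ ε * ‖v₁‖ := by
    rw [norm_smul, Real.norm_of_nonneg hs.1]
    exact mul_le_mul_of_nonneg_right hs.2 (norm_nonneg _)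
  have h2 : ‖(s ^ 2 / (2 * ε)) • (m - v₁)‖ ≤ (ε / 2) * (‖m‖ + ‖v₁‖) := by
    rw [norm_smul, Real.norm_of_nonneg (by positivity)]
    have hs2 : s ^ 2 / (2 * ε) ≤ ε / 2 := by
      rw [div_le_div_iff₀ (by positivity) (by positivity)]
      nlinarith [hs.1, hs.2]
    exact mul_le_mul hs2 (norm_sub_le _ _) (norm_nonneg _) (by positivity)
  calc ‖s • v₁ + (s ^ 2 / (2 * ε)) • (m - v₁)‖
      ≤ ‖s • v₁‖ + ‖(s ^ 2 / (2 * ε)) • (m - v₁)‖ := norm_add_le _ _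
    _ ≤ ε * ‖v₁‖ + (ε / 2) * (‖m‖ + ‖v₁‖) := add_le_add h1 h2
    _ ≤ 2 * ε * (‖v₁‖ + ‖m‖) := by nlinarith [norm_nonneg v₁, norm_nonneg m, hε]

/-- Derivative of the wiggle. [folklore] -/
theorem hasDerivAt_Wg (s : ℝ) :
    HasDerivAt (Wg x₀ v₁ d ε T) (Wg' v₁ d ε T s) s := by
  have hin : HasDerivAt (fun s : ℝ ↦ (s - ε) / T) (1 / T) s := by
    simpa using ((hasDerivAt_id' s).sub_const ε).div_const T
  have hB := (hasDerivAt_Bst ((s - ε) / T)).comp s hin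
  have h1 := ((hB.const_sub 1).const_mul (ε / 2)).smul_const v₁
  have h2 : HasDerivAt (fun s : ℝ ↦ (s - ε / 2) • d) ((1 : ℝ) • d) s :=
    ((hasDerivAt_id' s).sub_const (ε / 2)).smul_const d
  have h := (h1.add h2).const_add x₀
  convert h using 1
  · funext s; simp only [Wg, Pi.add_apply, Function.comp_apply, add_assoc]
  · simp only [Wg', one_smul]
    module

/-- The wiggle at `ε`. [folklore] -/
theorem Wg_eps : Wg x₀ v₁ d ε T ε = x₀ + (ε / 2) • v₁ + (ε / 2) • d := by
  simp only [Wg, sub_self, zero_div, Bst_zero, sub_zero, mul_one]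
  congr 2; ring

/-- The wiggle starts with velocity `d`. [folklore] -/
theorem Wg'_eps : Wg' v₁ d ε T ε = d := by simp [Wg', Bst'_zero]

/-- The wiggle at `ε + T`. [folklore] -/
theorem Wg_end (hT : T ≠ 0) : Wg x₀ v₁ d ε T (ε + T) = Sl x₀ d ε (ε + T) := by
  simp [Wg, Sl, div_self hT, Bst_one]

/-- The wiggle ends with velocity `d`. [folklore] -/
theorem Wg'_end (hT : T ≠ 0) : Wg' v₁ d ε T (ε + T) = d := by
  simp [Wg', div_self hT, Bst'_one]

/-- The wiggle as a midpoint. [folklore] -/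
theorem Wg_eq_midpoint (s : ℝ) : Wg x₀ v₁ d ε T s =
    (1 / 2 : ℝ) • (x₀ + (ε * (1 - Bst ((s - ε) / T))) • v₁) +
      (1 / 2 : ℝ) • (x₀ + (2 * s - ε) • d) := by
  simp only [Wg]
  module

/-- Position bound for the wiggle. [folklore] -/
theorem dist_Wg_le (hε : 0 ≤ ε) {s : ℝ} (hs : s ∈ Icc ε (ε + T)) (hT : 0 < T) :
    dist (Wg x₀ v₁ d ε T s) x₀ ≤ ε * ‖v₁‖ + (s - ε / 2) * ‖d‖ := by
  rw [dist_eq_norm, Wg, add_assoc, add_sub_cancel_left]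
  have ht : (s - ε) / T ∈ Icc (0 : ℝ) 1 :=
    ⟨div_nonneg (by linarith [hs.1]) hT.le, (div_le_one hT).mpr (by linarith [hs.2])⟩
  have hB0 := Bst_nonneg ht
  have hB1 := Bst_le_one ht
  have h1 : ‖((ε / 2) * (1 - Bst ((s - ε) / T))) • v₁‖ ≤ ε * ‖v₁‖ := by
    rw [norm_smul, Real.norm_of_nonneg (by nlinarith)]
    exact mul_le_mul_of_nonneg_right (by nlinarith) (norm_nonneg _)
  have h2 : ‖(s - ε / 2) • d‖ = (s - ε / 2) * ‖d‖ := by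
    rw [norm_smul, Real.norm_of_nonneg (by linarith [hs.1])]
  linarith [norm_add_le (((ε / 2) * (1 - Bst ((s - ε) / T))) • v₁) ((s - ε / 2) • d)]

/-- Velocity bound for the wiggle. [folklore] -/
theorem dist_Wg'_le (hε : 0 ≤ ε) {s : ℝ} (hs : s ∈ Icc ε (ε + T)) (hT : 0 < T) :
    dist (Wg' v₁ d ε T s) d ≤ 3 * ε / (4 * T) * ‖v₁‖ := by
  rw [dist_eq_norm, Wg', sub_sub_cancel_left, norm_neg, norm_smul]
  have ht : (s - ε) / T ∈ Icc (0 : ℝ) 1 :=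
    ⟨div_nonneg (by linarith [hs.1]) hT.le, (div_le_one hT).mpr (by linarith [hs.2])⟩
  have hB := abs_Bst'_le ht
  refine mul_le_mul_of_nonneg_right ?_ (norm_nonneg _)
  rw [Real.norm_eq_abs, abs_div, abs_mul, abs_of_nonneg (by linarith : 0 ≤ ε / 2), abs_of_pos hT,
    div_le_div_iff₀ hT (by positivity)]
  nlinarith [mul_le_mul_of_nonneg_left hB (by positivity : (0 : ℝ) ≤ ε * T)]

/-- Derivative of the straight piece. [folklore] -/
theorem hasDerivAt_Sl (s : ℝ) : HasDerivAt (Sl x₀ d ε) d s := by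
  have h := (((hasDerivAt_id' s).sub_const (ε / 2)).smul_const d).const_add x₀
  rw [one_smul] at h
  exact h

/-- Position of the straight piece. [folklore] -/
theorem dist_Sl (s : ℝ) : dist (Sl x₀ d ε s) x₀ = |s - ε / 2| * ‖d‖ := by
  rw [dist_eq_norm, Sl, add_sub_cancel_left, norm_smul, Real.norm_eq_abs]

/-- The half curve on `(-∞, ε]`. [folklore] -/
theorem Hc_of_le {s : ℝ} (hs : s ≤ ε) : Hc x₀ v₁ d ε T s = σ₁ x₀ v₁ d ε s := by simp [Hc, hs]

/-- The velocity of the half curve on `(-∞, ε]`. [folklore] -/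
theorem Hc'_of_le {s : ℝ} (hs : s ≤ ε) : Hc' v₁ d ε T s = σ₁' v₁ d ε s := by simp [Hc', hs]

/-- The half curve on `[ε, ε + T]`. [folklore] -/
theorem Hc_of_mem (hε : ε ≠ 0) {s : ℝ} (hs : s ∈ Icc ε (ε + T)) :
    Hc x₀ v₁ d ε T s = Wg x₀ v₁ d ε T s := by
  rcases hs.1.eq_or_lt with rfl | hlt
  · rw [Hc_of_le le_rfl, σ₁_eps hε, Wg_eps]
  · simp [Hc, not_le.mpr hlt, hs.2]

/-- The velocity of the half curve on `[ε, ε + T]`. [folklore] -/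
theorem Hc'_of_mem (hε : ε ≠ 0) {s : ℝ} (hs : s ∈ Icc ε (ε + T)) :
    Hc' v₁ d ε T s = Wg' v₁ d ε T s := by
  rcases hs.1.eq_or_lt with rfl | hlt
  · rw [Hc'_of_le le_rfl, σ₁'_eps hε, Wg'_eps]
  · simp [Hc', not_le.mpr hlt, hs.2]

/-- The half curve on `[ε + T, ∞)`. [folklore] -/
theorem Hc_of_ge (hT : 0 < T) {s : ℝ} (hs : ε + T ≤ s) : Hc x₀ v₁ d ε T s = Sl x₀ d ε s := by
  have h1 : ¬ s ≤ ε := by linarith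
  rcases hs.eq_or_lt with rfl | hlt
  · simp [Hc, h1, Wg_end hT.ne']
  · simp [Hc, h1, not_le.mpr hlt]

/-- The velocity of the half curve on `[ε + T, ∞)`. [folklore] -/
theorem Hc'_of_ge (hT : 0 < T) {s : ℝ} (hs : ε + T ≤ s) : Hc' v₁ d ε T s = d := by
  have h1 : ¬ s ≤ ε := by linarith
  rcases hs.eq_or_lt with rfl | hlt
  · simp [Hc', h1, Wg'_end hT.ne']
  · simp [Hc', h1, not_le.mpr hlt]

/-- The half curve is differentiable everywhere. [folklore] -/
theorem hasDerivAt_Hc (hε : 0 < ε) (hT : 0 < T) (s : ℝ) :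
    HasDerivAt (Hc x₀ v₁ d ε T) (Hc' v₁ d ε T s) s := by
  rcases lt_trichotomy s ε with h1 | heq | h1
  · have hev : Hc x₀ v₁ d ε T =ᶠ[𝓝 s] σ₁ x₀ v₁ d ε := by
      filter_upwards [Iio_mem_nhds h1] with s' hs' using Hc_of_le (le_of_lt hs')
    rw [Hc'_of_le h1.le]
    exact (hasDerivAt_σ₁ hε.ne' s).congr_of_eventuallyEq hev
  · rw [heq, Hc'_of_le le_rfl, σ₁'_eps hε.ne']
    refine hasDerivAt_of_Iic_Ici' ?_ ?_
    · have h := (hasDerivAt_σ₁ (x₀ := x₀) (v₁ := v₁) (m := d) hε.ne' ε).hasDerivWithinAt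
        (s := Iic ε)
      rw [σ₁'_eps hε.ne'] at h
      exact h.congr (fun s' hs' ↦ Hc_of_le hs') (Hc_of_le le_rfl)
    · have h := (hasDerivAt_Wg (x₀ := x₀) (v₁ := v₁) (d := d) (ε := ε) (T := T) ε).hasDerivWithinAt
        (s := Ici ε)
      rw [Wg'_eps] at h
      refine h.congr_of_eventuallyEq ?_ (Hc_of_mem hε.ne' ⟨le_rfl, by linarith⟩)
      filter_upwards [Icc_mem_nhdsGE (show ε < ε + T by linarith)] with s' hs'
        using Hc_of_mem hε.ne' hs'
  · rcases lt_trichotomy s (ε + T) with h2 | rfl | h2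
    · have hev : Hc x₀ v₁ d ε T =ᶠ[𝓝 s] Wg x₀ v₁ d ε T := by
        filter_upwards [Ioo_mem_nhds h1 h2] with s' hs' using Hc_of_mem hε.ne' ⟨hs'.1.le, hs'.2.le⟩
      rw [Hc'_of_mem hε.ne' ⟨h1.le, h2.le⟩]
      exact (hasDerivAt_Wg s).congr_of_eventuallyEq hev
    · rw [Hc'_of_ge hT le_rfl]
      refine hasDerivAt_of_Iic_Ici' ?_ ?_
      · have h := (hasDerivAt_Wg (x₀ := x₀) (v₁ := v₁) (d := d) (ε := ε) (T := T) (ε + T)).hasDerivWithinAt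
          (s := Iic (ε + T))
        rw [Wg'_end hT.ne'] at h
        refine h.congr_of_eventuallyEq ?_ (Hc_of_mem hε.ne' ⟨by linarith, le_rfl⟩)
        filter_upwards [Icc_mem_nhdsLE (show ε < ε + T by linarith)] with s' hs'
          using Hc_of_mem hε.ne' hs'
      · refine (hasDerivAt_Sl (x₀ := x₀) (d := d) (ε := ε) (ε + T)).hasDerivWithinAt.congr_of_eventuallyEq
          ?_ (Hc_of_ge hT le_rfl)
        filter_upwards [self_mem_nhdsWithin] with s' hs' using Hc_of_ge hT hs'
    · have hev : Hc x₀ v₁ d ε T =ᶠ[𝓝 s] Sl x₀ d ε := by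
        filter_upwards [Ioi_mem_nhds h2] with s' hs' using Hc_of_ge hT (le_of_lt hs')
      rw [Hc'_of_ge hT h2.le]
      exact (hasDerivAt_Sl s).congr_of_eventuallyEq hev

end Pieces

/-! ### The half curve: defect, position and velocity bounds -/

section HalfCurve

variable {R : Set F} {x₀ v₁ d : F} {ε T δ ℓ : ℝ}

/-- On `[ε/2, ε]` the clamp profile is at least `ε/2`. [folklore] -/
theorem θp_ge_half (hε : 0 < ε) {s : ℝ} (hs : s ∈ Icc (ε / 2) ε) : ε / 2 ≤ θp ε ℓ s := by
  by_cases h1 : s ≤ ε / 2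
  · rw [θp_of_le_half h1]; exact hs.1
  · simp only [θp, h1, hs.2, if_false, if_true]
    have : (s - ε / 2) ^ 2 / ε ≤ (s - ε / 2) := by
      rw [div_le_iff₀ hε]; nlinarith [hs.1, hs.2]
    linarith

/-- **Defect of the half curve.** If `x₀ + a d ∈ R` for `a ∈ [0, δ]` and
`e(a) = infDist (x₀ + a v₁) R` (convex, vanishing at `0`), then along the half curve with
`T = δ/8`, `ℓ = δ/4`, `0 < ε ≤ δ/8`, the distance to `R` is at most half the majorant
`G_e(θ(t))`, for `t ∈ [0, (δ + ε)/2]`. [folklore] -/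
theorem infDist_Hc_le (hR : Convex ℝ R) (hseg : ∀ a ∈ Icc (0 : ℝ) δ, x₀ + a • d ∈ R)
    (hδ : 0 < δ) (hε : 0 < ε) (hεδ : ε ≤ δ / 8) (hT : T = δ / 8) (hℓ : ℓ = δ / 4)
    (hec : ConvexOn ℝ univ (fun a : ℝ ↦ infDist (x₀ + a • v₁) R))
    (hecont : Continuous (fun a : ℝ ↦ infDist (x₀ + a • v₁) R))
    (heo : Tendsto (fun a : ℝ ↦ infDist (x₀ + a • v₁) R / a) (𝓝[>] 0) (𝓝 0))
    {t : ℝ} (ht : t ∈ Icc 0 ((δ + ε) / 2)) :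
    infDist (Hc x₀ v₁ d ε T t) R ≤ Gm (fun a : ℝ ↦ infDist (x₀ + a • v₁) R) (θp ε ℓ t) / 2 := by
  set e : ℝ → ℝ := fun a ↦ infDist (x₀ + a • v₁) R with he
  have hx₀ : x₀ ∈ R := by simpa using hseg 0 ⟨le_rfl, hδ.le⟩
  have hne : R.Nonempty := ⟨x₀, hx₀⟩
  have he0 : e 0 = 0 := by simp [he, infDist_zero_of_mem hx₀]
  have henn : ∀ a, 0 ≤ e a := fun a ↦ infDist_nonneg
  have hmono : ∀ {a b : ℝ}, 0 ≤ a → a ≤ b → e a ≤ e b := fun ha hab ↦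
    le_of_convexOn hec he0 henn ha hab
  have hTpos : 0 < T := by rw [hT]; positivity
  have hℓpos : 0 < ℓ := by rw [hℓ]; positivity
  have hθ : θp ε ℓ t ∈ Icc 0 ε := θp_mem hε hℓpos ht.1
  have hG : e (4 * θp ε ℓ t) ≤ Gm e (θp ε ℓ t) := le_Gm hec he0 henn hecont heo hθ.1
  by_cases h1 : t ≤ ε
  · -- first piece
    rw [Hc_of_le h1, σ₁_eq_midpoint]
    refine (Literature.Analysis.Convex.infDist_midpoint_le hR hne _ _).trans ?_
    have hmem : x₀ + (t ^ 2 / ε) • d ∈ R := by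
      refine hseg _ ⟨by positivity, ?_⟩
      rw [div_le_iff₀ hε]; nlinarith [ht.1, h1]
    rw [infDist_zero_of_mem hmem, add_zero]
    have hb : e (2 * t - t ^ 2 / ε) ≤ e (4 * θp ε ℓ t) := by
      refine hmono ?_ ?_
      · have : t ^ 2 / ε ≤ t := by rw [div_le_iff₀ hε]; nlinarith [ht.1, h1]
        linarith [ht.1]
      · have : 0 ≤ t ^ 2 / ε := by positivity
        by_cases h2 : t ≤ ε / 2
        · rw [θp_of_le_half h2]; linarith [ht.1]
        · have := θp_ge_half (ℓ := ℓ) hε ⟨(not_le.mp h2).le, h1⟩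
          linarith
    change e (2 * t - t ^ 2 / ε) / 2 ≤ Gm e (θp ε ℓ t) / 2
    linarith
  · by_cases h2 : t ≤ ε + T
    · -- wiggle
      rw [Hc_of_mem hε.ne' ⟨(not_le.mp h1).le, h2⟩, Wg_eq_midpoint]
      refine (Literature.Analysis.Convex.infDist_midpoint_le hR hne _ _).trans ?_
      have hmem : x₀ + (2 * t - ε) • d ∈ R := hseg _ ⟨by linarith [not_le.mp h1], by linarith⟩
      rw [infDist_zero_of_mem hmem, add_zero]
      have hBt : (t - ε) / T ∈ Icc (0 : ℝ) 1 :=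
        ⟨div_nonneg (by linarith [not_le.mp h1]) hTpos.le, (div_le_one hTpos).mpr (by linarith)⟩
      have hB0 := Bst_nonneg hBt
      have hB1 := Bst_le_one hBt
      have hb : e (ε * (1 - Bst ((t - ε) / T))) ≤ e (4 * θp ε ℓ t) := by
        refine hmono (by nlinarith) ?_
        have := θp_ge hε hℓpos (s := t) ⟨by linarith [not_le.mp h1], by rw [hℓ]; linarith⟩
        nlinarith
      change e (ε * (1 - Bst ((t - ε) / T))) / 2 ≤ Gm e (θp ε ℓ t) / 2
      linarith
    · -- straight
      rw [Hc_of_ge hTpos (not_le.mp h2).le]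
      have hmem : Sl x₀ d ε t ∈ R := hseg _ ⟨by linarith [not_le.mp h2], by linarith [ht.2]⟩
      rw [infDist_zero_of_mem hmem]
      linarith [(henn _).trans hG]

/-- Position bound for the half curve on the first piece. [folklore] -/
theorem dist_Hc_le_of_le (hε : 0 < ε) {t : ℝ} (ht : t ∈ Icc 0 ε) :
    dist (Hc x₀ v₁ d ε T t) x₀ ≤ 2 * ε * (‖v₁‖ + ‖d‖) := by
  rw [Hc_of_le ht.2]; exact dist_σ₁_le hε ht

/-- Position bound for the half curve after the first piece. [folklore] -/
theorem dist_Hc_le_of_ge (hε : 0 < ε) (hT : 0 < T) {t : ℝ} (ht : t ∈ Icc ε ((δ + ε) / 2))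
    (hεδ : ε ≤ δ) : dist (Hc x₀ v₁ d ε T t) x₀ ≤ ε * ‖v₁‖ + δ * ‖d‖ := by
  by_cases h2 : t ≤ ε + T
  · rw [Hc_of_mem hε.ne' ⟨ht.1, h2⟩]
    refine (dist_Wg_le hε.le ⟨ht.1, h2⟩ hT).trans ?_
    have : (t - ε / 2) * ‖d‖ ≤ δ * ‖d‖ :=
      mul_le_mul_of_nonneg_right (by linarith [ht.2]) (norm_nonneg _)
    linarith
  · rw [Hc_of_ge hT (not_le.mp h2).le, dist_Sl, abs_of_nonneg (by linarith [ht.1])]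
    have : (t - ε / 2) * ‖d‖ ≤ δ * ‖d‖ :=
      mul_le_mul_of_nonneg_right (by linarith [ht.2]) (norm_nonneg _)
    nlinarith [norm_nonneg v₁]

/-- Velocity of the half curve on the first piece. [folklore] -/
theorem Hc'_of_le' {t : ℝ} (ht : t ≤ ε) : Hc' v₁ d ε T t = (1 - t / ε) • v₁ + (t / ε) • d := by
  rw [Hc'_of_le ht, σ₁'_eq]

/-- Velocity bound for the half curve after the first piece. [folklore] -/
theorem dist_Hc'_le_of_ge (hε : 0 < ε) (hT : 0 < T) {t : ℝ} (ht : ε ≤ t) :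
    dist (Hc' v₁ d ε T t) d ≤ 3 * ε / (4 * T) * ‖v₁‖ := by
  by_cases h2 : t ≤ ε + T
  · rw [Hc'_of_mem hε.ne' ⟨ht, h2⟩]; exact dist_Wg'_le hε.le ⟨ht, h2⟩ hT
  · rw [Hc'_of_ge hT (not_le.mp h2).le, dist_self]; positivity

/-- Values of the half curve: at `0`. [folklore] -/
theorem Hc_zero (hε : 0 < ε) : Hc x₀ v₁ d ε T 0 = x₀ := by rw [Hc_of_le hε.le, σ₁_zero]

/-- Velocity of the half curve at `0`. [folklore] -/
theorem Hc'_zero (hε : 0 < ε) : Hc' v₁ d ε T 0 = v₁ := by rw [Hc'_of_le hε.le, σ₁'_zero]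

end HalfCurve

/-! ### Tube lemma -/

/-- Tube lemma around a segment `{x} × [u, u']` contained in an open subset of `F × F`.
[folklore] -/
theorem exists_tube_segment {K : Set (F × F)} (hK : IsOpen K) {x u u' : F}
    (h : ∀ θ ∈ Icc (0 : ℝ) 1, (x, (1 - θ) • u + θ • u') ∈ K) :
    ∃ η > 0, ∀ (x' u'' : F) (θ : ℝ), θ ∈ Icc (0 : ℝ) 1 → dist x' x < η →
      dist u'' ((1 - θ) • u + θ • u') < η → (x', u'') ∈ K := by
  set f : ℝ → F × F := fun θ ↦ (x, (1 - θ) • u + θ • u') with hf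
  have hfc : Continuous f := by fun_prop
  have hC : IsCompact (f '' Icc 0 1) := isCompact_Icc.image hfc
  have hCK : f '' Icc 0 1 ⊆ K := by
    rintro _ ⟨θ, hθ, rfl⟩
    exact h θ hθ
  obtain ⟨η, hη, hsub⟩ := hC.exists_thickening_subset_open hK hCK
  refine ⟨η, hη, fun x' u'' θ hθ hx hu ↦ hsub ?_⟩
  rw [mem_thickening_iff]
  refine ⟨f θ, mem_image_of_mem f hθ, ?_⟩
  rw [Prod.dist_eq]
  exact max_lt hx hu

/-! ### The base curve: two half curves glued in the middle -/

section BaseCurve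

variable {x₀ y v₁ w d : F} {ε T L δ : ℝ}

/-- The base curve: the half curve from `x₀` on `[0, L/2]`, the reversed half curve from `y` on
`[L/2, L]`. [folklore] -/
def σb (x₀ y v₁ w d : F) (ε T L s : ℝ) : F :=
  if s ≤ L / 2 then Hc x₀ v₁ d ε T s else Hc y (-w) (-d) ε T (L - s)

/-- Velocity of the base curve. [folklore] -/
def σb' (v₁ w d : F) (ε T L s : ℝ) : F :=
  if s ≤ L / 2 then Hc' v₁ d ε T s else -Hc' (-w) (-d) ε T (L - s)

/-- The base curve on the left half. [folklore] -/
theorem σb_of_le {s : ℝ} (h : s ≤ L / 2) : σb x₀ y v₁ w d ε T L s = Hc x₀ v₁ d ε T s := by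
  simp [σb, h]

/-- The velocity of the base curve on the left half. [folklore] -/
theorem σb'_of_le {s : ℝ} (h : s ≤ L / 2) : σb' v₁ w d ε T L s = Hc' v₁ d ε T s := by
  simp [σb', h]

/-- The base curve on the right half. [folklore] -/
theorem σb_of_gt {s : ℝ} (h : L / 2 < s) :
    σb x₀ y v₁ w d ε T L s = Hc y (-w) (-d) ε T (L - s) := by
  simp [σb, not_le.mpr h]

/-- The velocity of the base curve on the right half. [folklore] -/
theorem σb'_of_gt {s : ℝ} (h : L / 2 < s) :
    σb' v₁ w d ε T L s = -Hc' (-w) (-d) ε T (L - s) := by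
  simp [σb', not_le.mpr h]

/-- In the middle the base curve is the straight line. [folklore] -/
theorem σb_mid (hy : y = x₀ + δ • d) (hL : L = δ + ε) (hT : 0 < T) {s : ℝ}
    (hs : s ∈ Ioo (ε + T) (L - ε - T)) :
    σb x₀ y v₁ w d ε T L s = Sl x₀ d ε s ∧ σb' v₁ w d ε T L s = d := by
  rcases le_or_gt s (L / 2) with h | h
  · rw [σb_of_le h, σb'_of_le h]
    exact ⟨Hc_of_ge hT hs.1.le, Hc'_of_ge hT hs.1.le⟩
  · rw [σb_of_gt h, σb'_of_gt h]
    have hs' : ε + T ≤ L - s := by linarith [hs.2]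
    refine ⟨?_, ?_⟩
    · rw [Hc_of_ge hT hs', Sl, Sl, hy, hL]
      module
    · rw [Hc'_of_ge hT hs', neg_neg]

/-- The base curve is differentiable everywhere. [folklore] -/
theorem hasDerivAt_σb (hy : y = x₀ + δ • d) (hL : L = δ + ε) (hε : 0 < ε) (hT : 0 < T)
    (hm₁ : ε + T < L / 2) (s : ℝ) :
    HasDerivAt (σb x₀ y v₁ w d ε T L) (σb' v₁ w d ε T L s) s := by
  by_cases hm : s ∈ Ioo (ε + T) (L - ε - T)
  · have hev : σb x₀ y v₁ w d ε T L =ᶠ[𝓝 s] Sl x₀ d ε := by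
      filter_upwards [Ioo_mem_nhds hm.1 hm.2] with s' hs' using (σb_mid hy hL hT hs').1
    rw [(σb_mid hy hL hT hm).2]
    exact (hasDerivAt_Sl s).congr_of_eventuallyEq hev
  · rcases le_or_gt s (ε + T) with hs | hs
    · have hlt : s < L / 2 := by linarith
      have hev : σb x₀ y v₁ w d ε T L =ᶠ[𝓝 s] Hc x₀ v₁ d ε T := by
        filter_upwards [Iio_mem_nhds hlt] with s' hs' using σb_of_le (le_of_lt hs')
      rw [σb'_of_le hlt.le]
      exact (hasDerivAt_Hc hε hT s).congr_of_eventuallyEq hev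
    · have hge : L - ε - T ≤ s := by
        by_contra h
        exact hm ⟨hs, not_le.mp h⟩
      have hgt : L / 2 < s := by linarith
      have hev : σb x₀ y v₁ w d ε T L =ᶠ[𝓝 s] (Hc y (-w) (-d) ε T ∘ fun s ↦ L - s) := by
        filter_upwards [Ioi_mem_nhds hgt] with s' hs' using σb_of_gt hs'
      rw [σb'_of_gt hgt]
      have h := (hasDerivAt_Hc (x₀ := y) (v₁ := -w) (d := -d) hε hT (L - s)).scomp s
        ((hasDerivAt_id' s).const_sub L)
      rw [neg_one_smul] at h
      exact h.congr_of_eventuallyEq hev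

/-- The base curve starts at `x₀`. [folklore] -/
theorem σb_zero (hε : 0 < ε) (hL : 0 ≤ L) : σb x₀ y v₁ w d ε T L 0 = x₀ := by
  rw [σb_of_le (by linarith), Hc_zero hε]

/-- The base curve starts with velocity `v₁`. [folklore] -/
theorem σb'_zero (hε : 0 < ε) (hL : 0 ≤ L) : σb' v₁ w d ε T L 0 = v₁ := by
  rw [σb'_of_le (by linarith), Hc'_zero hε]

/-- The base curve ends at `y`. [folklore] -/
theorem σb_L (hε : 0 < ε) (hL : 0 < L) : σb x₀ y v₁ w d ε T L L = y := by
  rw [σb_of_gt (by linarith), sub_self, Hc_zero hε]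

/-- The base curve ends with velocity `w`. [folklore] -/
theorem σb'_L (hε : 0 < ε) (hL : 0 < L) : σb' v₁ w d ε T L L = w := by
  rw [σb'_of_gt (by linarith), sub_self, Hc'_zero hε, neg_neg]

/-- Zone 1: the first corner piece. [folklore] -/
theorem σb_zone₁ (hε : 0 < ε) (hL : 2 * ε ≤ L) {s : ℝ} (hs : s ∈ Icc 0 ε) :
    dist (σb x₀ y v₁ w d ε T L s) x₀ ≤ 2 * ε * (‖v₁‖ + ‖d‖) ∧
      σb' v₁ w d ε T L s = (1 - s / ε) • v₁ + (s / ε) • d := by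
  have h : s ≤ L / 2 := by linarith [hs.2]
  rw [σb_of_le h, σb'_of_le h]
  exact ⟨dist_Hc_le_of_le hε hs, Hc'_of_le' hs.2⟩

/-- Zone 2: wiggle and straight piece of the left half. [folklore] -/
theorem σb_zone₂ (hε : 0 < ε) (hT : 0 < T) (hL : L = δ + ε) (hεδ : ε ≤ δ) {s : ℝ}
    (hs : s ∈ Icc ε (L / 2)) :
    dist (σb x₀ y v₁ w d ε T L s) x₀ ≤ ε * ‖v₁‖ + δ * ‖d‖ ∧
      dist (σb' v₁ w d ε T L s) d ≤ 3 * ε / (4 * T) * ‖v₁‖ := by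
  rw [σb_of_le hs.2, σb'_of_le hs.2]
  refine ⟨dist_Hc_le_of_ge hε hT ⟨hs.1, ?_⟩ hεδ, dist_Hc'_le_of_ge hε hT hs.1⟩
  rw [hL] at hs; exact hs.2

/-- Zone 3: straight piece and wiggle of the right half. [folklore] -/
theorem σb_zone₃ (hε : 0 < ε) (hT : 0 < T) (hL : L = δ + ε) (hεδ : ε ≤ δ) {s : ℝ}
    (hs : L / 2 < s) (hs' : s ≤ L - ε) :
    dist (σb x₀ y v₁ w d ε T L s) y ≤ ε * ‖w‖ + δ * ‖d‖ ∧
      dist (σb' v₁ w d ε T L s) d ≤ 3 * ε / (4 * T) * ‖w‖ := by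
  rw [σb_of_gt hs, σb'_of_gt hs]
  constructor
  · have h := dist_Hc_le_of_ge (x₀ := y) (v₁ := -w) (d := -d) hε hT (δ := δ) (t := L - s)
      ⟨by linarith, by rw [hL] at hs ⊢; linarith⟩ hεδ
    rwa [norm_neg, norm_neg] at h
  · have h := dist_Hc'_le_of_ge (v₁ := -w) (d := -d) hε hT (t := L - s) (by linarith)
    rw [norm_neg] at h
    rw [dist_eq_norm] at h ⊢
    rwa [show -Hc' (-w) (-d) ε T (L - s) - d = -(Hc' (-w) (-d) ε T (L - s) - -d) by abel,
      norm_neg]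

/-- Zone 4: the final corner piece. [folklore] -/
theorem σb_zone₄ (hε : 0 < ε) (hL : 2 * ε < L) {s : ℝ} (hs : s ∈ Icc (L - ε) L) :
    dist (σb x₀ y v₁ w d ε T L s) y ≤ 2 * ε * (‖w‖ + ‖d‖) ∧
      σb' v₁ w d ε T L s = (1 - (L - s) / ε) • w + ((L - s) / ε) • d := by
  have h : L / 2 < s := by linarith [hs.1]
  rw [σb_of_gt h, σb'_of_gt h]
  have hs' : L - s ∈ Icc 0 ε := ⟨by linarith [hs.2], by linarith [hs.1]⟩
  refine ⟨?_, ?_⟩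
  · have := dist_Hc_le_of_le (x₀ := y) (v₁ := -w) (d := -d) (T := T) hε hs'
    rwa [norm_neg, norm_neg] at this
  · rw [Hc'_of_le' hs'.2]; module

/-- Global bounds for the base curve: positions `r`-close to `x₀`, speeds at most `C₀`.
[folklore] -/
theorem σb_global {r η C₀ : ℝ} (hηpos : 0 < η) (hε : 0 < ε) (hTpos : 0 < T)
    (hT : T = δ / 8) (hL : L = δ + ε) (hεδ : ε ≤ δ / 8) (hyr : dist y x₀ < r / 4) (hyd : δ * ‖d‖ < r / 4) (hc3 : 2 * ε * C₀ < η)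
    (hc4 : 6 * ε / δ * C₀ < η) (hηr : 8 * η ≤ r) (hη1 : 8 * η ≤ 1)
    (hC₀ : C₀ = ‖v₁‖ + ‖w‖ + ‖d‖ + 1) {s : ℝ} (hs : s ∈ Icc 0 L) :
    dist (σb x₀ y v₁ w d ε T L s) x₀ < r ∧ ‖σb' v₁ w d ε T L s‖ ≤ C₀ := by
  have hδ : 0 < δ := by linarith
  have h6 : 3 * ε / (4 * T) = 6 * ε / δ := by rw [hT]; field_simp; ring
  have hn₁ := norm_nonneg v₁
  have hn₃ := norm_nonneg w
  have hnd := norm_nonneg d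
  have hcombo : ∀ θ : ℝ, θ ∈ Icc (0 : ℝ) 1 → ∀ u : F, ‖(1 - θ) • u + θ • d‖ ≤ ‖u‖ + ‖d‖ := by
    intro θ hθ u
    calc ‖(1 - θ) • u + θ • d‖ ≤ ‖(1 - θ) • u‖ + ‖θ • d‖ := norm_add_le _ _
      _ = (1 - θ) * ‖u‖ + θ * ‖d‖ := by
          rw [norm_smul, norm_smul, Real.norm_of_nonneg (by linarith [hθ.2]),
            Real.norm_of_nonneg hθ.1]
      _ ≤ ‖u‖ + ‖d‖ := by nlinarith [norm_nonneg u, norm_nonneg d, hθ.1, hθ.2]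
  rcases le_or_gt s ε with h1 | h1
  · obtain ⟨hp, hv⟩ := σb_zone₁ (x₀ := x₀) (y := y) (v₁ := v₁) (w := w) (d := d) (T := T) (L := L) hε
      (by linarith : 2 * ε ≤ L) ⟨hs.1, h1⟩
    refine ⟨?_, ?_⟩
    · have : 2 * ε * (‖v₁‖ + ‖d‖) ≤ 2 * ε * C₀ := by rw [hC₀]; nlinarith
      linarith
    · rw [hv]
      refine (hcombo _ ⟨div_nonneg hs.1 hε.le, (div_le_one hε).mpr h1⟩ v₁).trans ?_
      rw [hC₀]; linarith
  rcases le_or_gt s (L / 2) with h2 | h2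
  · obtain ⟨hp, hv⟩ := σb_zone₂ (x₀ := x₀) (y := y) (v₁ := v₁) (w := w) (d := d) hε hTpos hL (by linarith)
      ⟨h1.le, h2⟩
    rw [h6] at hv
    refine ⟨?_, ?_⟩
    · have : ε * ‖v₁‖ ≤ 2 * ε * C₀ := by rw [hC₀]; nlinarith
      linarith
    · have hv' : 6 * ε / δ * ‖v₁‖ ≤ 6 * ε / δ * C₀ :=
        mul_le_mul_of_nonneg_left (by rw [hC₀]; linarith) (by positivity)
      rw [dist_eq_norm] at hv
      have := norm_le_norm_add_norm_sub' (σb' v₁ w d ε T L s) d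
      rw [hC₀]; linarith
  rcases le_or_gt s (L - ε) with h3 | h3
  · obtain ⟨hp, hv⟩ := σb_zone₃ (x₀ := x₀) (y := y) (v₁ := v₁) (w := w) (d := d) hε hTpos hL (by linarith) h2 h3
    rw [h6] at hv
    refine ⟨?_, ?_⟩
    · have : ε * ‖w‖ ≤ 2 * ε * C₀ := by rw [hC₀]; nlinarith
      linarith [dist_triangle (σb x₀ y v₁ w d ε T L s) y x₀]
    · have hv' : 6 * ε / δ * ‖w‖ ≤ 6 * ε / δ * C₀ :=
        mul_le_mul_of_nonneg_left (by rw [hC₀]; linarith) (by positivity)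
      rw [dist_eq_norm] at hv
      have := norm_le_norm_add_norm_sub' (σb' v₁ w d ε T L s) d
      rw [hC₀]; linarith
  · obtain ⟨hp, hv⟩ := σb_zone₄ (x₀ := x₀) (y := y) (v₁ := v₁) (w := w) (d := d) (T := T) hε
      (by linarith : 2 * ε < L) ⟨h3.le, hs.2⟩
    refine ⟨?_, ?_⟩
    · have : 2 * ε * (‖w‖ + ‖d‖) ≤ 2 * ε * C₀ := by rw [hC₀]; nlinarith
      linarith [dist_triangle (σb x₀ y v₁ w d ε T L s) y x₀]
    · rw [hv]
      refine (hcombo _ ⟨div_nonneg (by linarith [hs.2]) hε.le,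
        (div_le_one hε).mpr (by linarith)⟩ w).trans ?_
      rw [hC₀]; linarith

/-- **Membership in `O` of points close to the base curve**: a point `(p, u)` with `p`
`η`-close to `σb(s)` and `u` `2η`-close to `σb'(s)` lies in `O`, by the tube about
`{x₀} × [v₁, d]` in zone 1, the product ball `B(x₀, r) × B(d, r/2)` in zones 2 and 3, and the
tube about `{y} × [w, d]` in zone 4. [folklore] -/
theorem pushed_mem_O {O : Set (F × F)} {r η C₀ ε₁ ε₃ : ℝ} (hηpos : 0 < η)
    (hε : 0 < ε) (hTpos : 0 < T) (hT : T = δ / 8) (hL : L = δ + ε) (hεδ : ε ≤ δ / 8) (hyr : dist y x₀ < r / 4)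
    (hyd : δ * ‖d‖ < r / 4) (hc3 : 2 * ε * C₀ < η) (hc4 : 6 * ε / δ * C₀ < η)
    (hηε₁ : 8 * η ≤ ε₁) (hηε₃ : 8 * η ≤ ε₃) (hηr : 8 * η ≤ r)
    (hC₀ : C₀ = ‖v₁‖ + ‖w‖ + ‖d‖ + 1)
    (hT₁ : ∀ (x' u'' : F) (θ : ℝ), θ ∈ Icc (0 : ℝ) 1 → dist x' x₀ < ε₁ →
      dist u'' ((1 - θ) • v₁ + θ • d) < ε₁ → (x', u'') ∈ O)
    (hT₃ : ∀ (x' u'' : F) (θ : ℝ), θ ∈ Icc (0 : ℝ) 1 → dist x' y < ε₃ →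
      dist u'' ((1 - θ) • w + θ • d) < ε₃ → (x', u'') ∈ O)
    (hmid : ∀ x u : F, dist x x₀ < r → dist u d < r / 2 → (x, u) ∈ O)
    {s : ℝ} (hs : s ∈ Icc 0 L) {p u : F} (hd1 : dist p (σb x₀ y v₁ w d ε T L s) < η)
    (hd2 : dist u (σb' v₁ w d ε T L s) < 2 * η) : (p, u) ∈ O := by
  have hδ : 0 < δ := by linarith
  have h6 : 3 * ε / (4 * T) = 6 * ε / δ := by rw [hT]; field_simp; ring
  have hn₁ := norm_nonneg v₁
  have hn₃ := norm_nonneg w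
  have hnd := norm_nonneg d
  rcases le_or_gt s ε with h1 | h1
  · obtain ⟨hp, hv⟩ := σb_zone₁ (x₀ := x₀) (y := y) (v₁ := v₁) (w := w) (d := d) (T := T) (L := L) hε
      (by linarith : 2 * ε ≤ L) ⟨hs.1, h1⟩
    refine hT₁ _ _ (s / ε) ⟨div_nonneg hs.1 hε.le, (div_le_one hε).mpr h1⟩ ?_ ?_
    · have : 2 * ε * (‖v₁‖ + ‖d‖) ≤ 2 * ε * C₀ := by rw [hC₀]; nlinarith
      linarith [dist_triangle p (σb x₀ y v₁ w d ε T L s) x₀]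
    · rw [← hv]; linarith
  rcases le_or_gt s (L / 2) with h2 | h2
  · obtain ⟨hp, hv⟩ := σb_zone₂ (x₀ := x₀) (y := y) (v₁ := v₁) (w := w) (d := d) hε hTpos hL (by linarith)
      ⟨h1.le, h2⟩
    rw [h6] at hv
    have hv' : 6 * ε / δ * ‖v₁‖ ≤ 6 * ε / δ * C₀ :=
      mul_le_mul_of_nonneg_left (by rw [hC₀]; linarith) (by positivity)
    refine hmid _ _ ?_ ?_
    · have : ε * ‖v₁‖ ≤ 2 * ε * C₀ := by rw [hC₀]; nlinarith
      linarith [dist_triangle p (σb x₀ y v₁ w d ε T L s) x₀]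
    · linarith [dist_triangle u (σb' v₁ w d ε T L s) d]
  rcases le_or_gt s (L - ε) with h3 | h3
  · obtain ⟨hp, hv⟩ := σb_zone₃ (x₀ := x₀) (y := y) (v₁ := v₁) (w := w) (d := d) hε hTpos hL (by linarith) h2 h3
    rw [h6] at hv
    have hv' : 6 * ε / δ * ‖w‖ ≤ 6 * ε / δ * C₀ :=
      mul_le_mul_of_nonneg_left (by rw [hC₀]; linarith) (by positivity)
    refine hmid _ _ ?_ ?_
    · have : ε * ‖w‖ ≤ 2 * ε * C₀ := by rw [hC₀]; nlinarith
      linarith [dist_triangle p (σb x₀ y v₁ w d ε T L s) x₀,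
        dist_triangle (σb x₀ y v₁ w d ε T L s) y x₀]
    · linarith [dist_triangle u (σb' v₁ w d ε T L s) d]
  · obtain ⟨hp, hv⟩ := σb_zone₄ (x₀ := x₀) (y := y) (v₁ := v₁) (w := w) (d := d) (T := T) hε
      (by linarith : 2 * ε < L) ⟨h3.le, hs.2⟩
    refine hT₃ _ _ ((L - s) / ε) ⟨div_nonneg (by linarith [hs.2]) hε.le,
      (div_le_one hε).mpr (by linarith)⟩ ?_ ?_
    · have : 2 * ε * (‖w‖ + ‖d‖) ≤ 2 * ε * C₀ := by rw [hC₀]; nlinarith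
      linarith [dist_triangle p (σb x₀ y v₁ w d ε T L s) y]
    · rw [← hv]; linarith

end BaseCurve

/-! ### The push coefficient -/

section Push

variable {e₁ e₃ : ℝ → ℝ} {ε ℓ L ρ : ℝ}

/-- The push coefficient `λ(s) = (G₁(θ(s)) + G₃(θ(L - s)))/ρ`. [folklore] -/
def lamf (e₁ e₃ : ℝ → ℝ) (ε ℓ L ρ s : ℝ) : ℝ :=
  (Gm e₁ (θp ε ℓ s) + Gm e₃ (θp ε ℓ (L - s))) / ρ

/-- Its derivative. [folklore] -/
def lamf' (e₁ e₃ : ℝ → ℝ) (ε ℓ L ρ s : ℝ) : ℝ :=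
  (Gm' e₁ (θp ε ℓ s) * θp' ε ℓ s + Gm' e₃ (θp ε ℓ (L - s)) * (θp' ε ℓ (L - s) * (-1))) / ρ

/-- The push coefficient is differentiable (chain rule). [folklore] -/
theorem hasDerivAt_lamf (h₁c : Continuous e₁) (h₁o : Tendsto (fun s ↦ e₁ s / s) (𝓝[>] 0) (𝓝 0))
    (h₃c : Continuous e₃) (h₃o : Tendsto (fun s ↦ e₃ s / s) (𝓝[>] 0) (𝓝 0)) (hε : 0 < ε)
    (hℓ : 0 < ℓ) (s : ℝ) : HasDerivAt (lamf e₁ e₃ ε ℓ L ρ) (lamf' e₁ e₃ ε ℓ L ρ s) s := by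
  have h1 := (hasDerivAt_Gm h₁c h₁o (θp ε ℓ s)).comp s (hasDerivAt_θp hε hℓ s)
  have h2 : HasDerivAt (fun s ↦ θp ε ℓ (L - s)) (θp' ε ℓ (L - s) * (-1)) s :=
    (hasDerivAt_θp hε hℓ (L - s)).comp s ((hasDerivAt_id' s).const_sub L)
  have h3 := (hasDerivAt_Gm h₃c h₃o (θp ε ℓ (L - s))).comp s h2
  have h := (h1.add h3).div_const ρ
  have hfun : lamf e₁ e₃ ε ℓ L ρ =
      fun x ↦ ((Gm e₁ ∘ θp ε ℓ) + (Gm e₃ ∘ fun s ↦ θp ε ℓ (L - s))) x / ρ := by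
    funext x
    simp [lamf, Function.comp_apply]
  rw [hfun]
  exact h

/-- `λ(0) = 0`. [folklore] -/
theorem lamf_zero (hε : 0 < ε) (hℓ : 0 < ℓ) (hL : ε + ℓ ≤ L) : lamf e₁ e₃ ε ℓ L ρ 0 = 0 := by
  simp only [lamf, sub_zero, θp_of_le_half (show (0 : ℝ) ≤ ε / 2 by positivity),
    θp_of_ge hε hL hℓ, Gm_of_nonpos le_rfl, add_zero, zero_div]

/-- `λ(L) = 0`. [folklore] -/
theorem lamf_L (hε : 0 < ε) (hℓ : 0 < ℓ) (hL : ε + ℓ ≤ L) : lamf e₁ e₃ ε ℓ L ρ L = 0 := by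
  simp only [lamf, sub_self, θp_of_le_half (show (0 : ℝ) ≤ ε / 2 by positivity),
    θp_of_ge hε hL hℓ, Gm_of_nonpos le_rfl, add_zero, zero_div]

/-- `λ'(0) = 0`. [folklore] -/
theorem lamf'_zero (hε : 0 < ε) (hℓ : 0 < ℓ) (hL : ε + ℓ ≤ L) : lamf' e₁ e₃ ε ℓ L ρ 0 = 0 := by
  simp only [lamf', sub_zero, θp_of_le_half (show (0 : ℝ) ≤ ε / 2 by positivity),
    θp_of_ge hε hL hℓ, Gm'_of_nonpos le_rfl, zero_mul, add_zero, zero_div]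

/-- `λ'(L) = 0`. [folklore] -/
theorem lamf'_L (hε : 0 < ε) (hℓ : 0 < ℓ) (hL : ε + ℓ ≤ L) : lamf' e₁ e₃ ε ℓ L ρ L = 0 := by
  simp only [lamf', sub_self, θp_of_le_half (show (0 : ℝ) ≤ ε / 2 by positivity),
    θp_of_ge hε hL hℓ, Gm'_of_nonpos le_rfl, zero_mul, add_zero, zero_div]

variable (H₁ : ConvexOn ℝ univ e₁ ∧ e₁ 0 = 0 ∧ (∀ s, 0 ≤ e₁ s) ∧ Continuous e₁ ∧
    Tendsto (fun s ↦ e₁ s / s) (𝓝[>] 0) (𝓝 0))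
  (H₃ : ConvexOn ℝ univ e₃ ∧ e₃ 0 = 0 ∧ (∀ s, 0 ≤ e₃ s) ∧ Continuous e₃ ∧
    Tendsto (fun s ↦ e₃ s / s) (𝓝[>] 0) (𝓝 0))
include H₁ H₃

/-- `λ ≥ 0`. [folklore] -/
theorem lamf_nonneg (hρ : 0 < ρ) (s : ℝ) : 0 ≤ lamf e₁ e₃ ε ℓ L ρ s :=
  div_nonneg (add_nonneg (Gm_nonneg H₁.1 H₁.2.1 H₁.2.2.1 H₁.2.2.2.1 H₁.2.2.2.2 _)
    (Gm_nonneg H₃.1 H₃.2.1 H₃.2.2.1 H₃.2.2.2.1 H₃.2.2.2.2 _)) hρ.le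

/-- `λ ρ` dominates each majorant. [folklore] -/
theorem Gm_le_lamf_mul (hρ : 0 < ρ) (s : ℝ) :
    Gm e₁ (θp ε ℓ s) ≤ lamf e₁ e₃ ε ℓ L ρ s * ρ ∧
      Gm e₃ (θp ε ℓ (L - s)) ≤ lamf e₁ e₃ ε ℓ L ρ s * ρ := by
  have h : lamf e₁ e₃ ε ℓ L ρ s * ρ = Gm e₁ (θp ε ℓ s) + Gm e₃ (θp ε ℓ (L - s)) := by
    rw [lamf, div_mul_cancel₀ _ hρ.ne']
  rw [h]
  have h1 := Gm_nonneg H₁.1 H₁.2.1 H₁.2.2.1 H₁.2.2.2.1 H₁.2.2.2.2 (θp ε ℓ s)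
  have h3 := Gm_nonneg H₃.1 H₃.2.1 H₃.2.2.1 H₃.2.2.2.1 H₃.2.2.2.2 (θp ε ℓ (L - s))
  constructor <;> linarith

/-- Upper bound `λ ≤ (e₁(8ε) + e₃(8ε))/(2ρ)` on `[0, L]`. [folklore] -/
theorem lamf_le (hρ : 0 < ρ) (hε : 0 < ε) (hℓ : 0 < ℓ) {s : ℝ} (hs : s ∈ Icc 0 L) :
    lamf e₁ e₃ ε ℓ L ρ s ≤ (e₁ (8 * ε) + e₃ (8 * ε)) / (2 * ρ) := by
  have h1 : θp ε ℓ s ∈ Icc 0 ε := θp_mem hε hℓ hs.1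
  have h2 : θp ε ℓ (L - s) ∈ Icc 0 ε := θp_mem hε hℓ (by linarith [hs.2])
  have hG1 := Gm_le H₁.1 H₁.2.1 H₁.2.2.1 H₁.2.2.2.1 H₁.2.2.2.2 h1.1
  have hG3 := Gm_le H₃.1 H₃.2.1 H₃.2.2.1 H₃.2.2.2.1 H₃.2.2.2.2 h2.1
  have hm1 : e₁ (8 * θp ε ℓ s) ≤ e₁ (8 * ε) :=
    le_of_convexOn H₁.1 H₁.2.1 H₁.2.2.1 (by linarith [h1.1]) (by linarith [h1.2])
  have hm3 : e₃ (8 * θp ε ℓ (L - s)) ≤ e₃ (8 * ε) :=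
    le_of_convexOn H₃.1 H₃.2.1 H₃.2.2.1 (by linarith [h2.1]) (by linarith [h2.2])
  rw [lamf, div_le_div_iff₀ hρ (by positivity)]
  nlinarith

/-- Derivative bound `|λ'| ≤ 8 (ψ₁(8ε) + ψ₃(8ε))/ρ` on `[0, L]` (when `9ε ≤ 8ℓ`). [folklore] -/
theorem abs_lamf'_le (hρ : 0 < ρ) (hε : 0 < ε) (hℓ : 0 < ℓ) (h98 : 9 * ε / (8 * ℓ) ≤ 1) {s : ℝ}
    (hs : s ∈ Icc 0 L) :
    |lamf' e₁ e₃ ε ℓ L ρ s| ≤ 8 * (ψ e₁ (8 * ε) + ψ e₃ (8 * ε)) / ρ := by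
  have h1 : θp ε ℓ s ∈ Icc 0 ε := θp_mem hε hℓ hs.1
  have h2 : θp ε ℓ (L - s) ∈ Icc 0 ε := θp_mem hε hℓ (by linarith [hs.2])
  have hG1 := abs_Gm'_le H₁.1 H₁.2.1 H₁.2.2.1 h1.2
  have hG3 := abs_Gm'_le H₃.1 H₃.2.1 H₃.2.2.1 h2.2
  have hmax : max 1 (9 * ε / (8 * ℓ)) = 1 := max_eq_left h98
  have hθ1 := abs_θp'_le hε hℓ s
  have hθ2 := abs_θp'_le hε hℓ (L - s)
  rw [hmax] at hθ1 hθ2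
  have hψ1 := ψ_nonneg H₁.2.2.1 (8 * ε)
  have hψ3 := ψ_nonneg H₃.2.2.1 (8 * ε)
  rw [lamf', abs_div, abs_of_pos hρ, div_le_div_iff₀ hρ hρ]
  have key : |Gm' e₁ (θp ε ℓ s) * θp' ε ℓ s +
      Gm' e₃ (θp ε ℓ (L - s)) * (θp' ε ℓ (L - s) * -1)| ≤
      8 * ψ e₁ (8 * ε) + 8 * ψ e₃ (8 * ε) := by
    refine (abs_add_le _ _).trans ?_
    rw [abs_mul, abs_mul, abs_mul, abs_neg, abs_one, mul_one]
    have := mul_le_mul hG1 hθ1 (abs_nonneg _) (by positivity)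
    have := mul_le_mul hG3 hθ2 (abs_nonneg _) (by positivity)
    linarith
  nlinarith [key]

end Push

/-! ### The pushed curve -/

/-- Derivative of a pushed curve `(1 - λ) σ + λ z`. [folklore] -/
theorem hasDerivAt_push {σ : ℝ → F} {σ' : F} {lam : ℝ → ℝ} {l' : ℝ} {z : F} {s : ℝ}
    (hσ : HasDerivAt σ σ' s) (hl : HasDerivAt lam l' s) :
    HasDerivAt (fun s ↦ (1 - lam s) • σ s + lam s • z) ((1 - lam s) • σ' + l' • (z - σ s)) s := by
  have h := ((hl.const_sub 1).smul hσ).add (hl.smul_const z)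
  have hfun : (fun s ↦ (1 - lam s) • σ s + lam s • z) =
      ((fun x ↦ 1 - lam x) • σ + fun y ↦ lam y • z) := by
    funext x
    simp [Pi.smul_apply']
  rw [hfun]
  refine h.congr_deriv ?_
  module

/-- Position deviation of a pushed point. [folklore] -/
theorem dist_push (p z : F) (t : ℝ) : dist ((1 - t) • p + t • z) p = |t| * ‖z - p‖ := by
  rw [dist_eq_norm, show (1 - t) • p + t • z - p = t • (z - p) by module, norm_smul,
    Real.norm_eq_abs]

/-- Velocity deviation of a pushed curve. [folklore] -/
theorem dist_push' (p u z : F) (t t' : ℝ) :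
    dist ((1 - t) • u + t' • (z - p)) u ≤ |t'| * ‖z - p‖ + |t| * ‖u‖ := by
  rw [dist_eq_norm, show (1 - t) • u + t' • (z - p) - u = t' • (z - p) - t • u by module]
  refine (norm_sub_le _ _).trans ?_
  rw [norm_smul, norm_smul, Real.norm_eq_abs, Real.norm_eq_abs]

/-! ### The choice of `ε` -/

/-- All smallness conditions on `ε` hold for small `ε > 0`. [folklore] -/
theorem exists_small {e₁ e₃ : ℝ → ℝ} (h₁c : Continuous e₁) (h₁0 : e₁ 0 = 0)
    (h₁o : Tendsto (fun s ↦ e₁ s / s) (𝓝[>] 0) (𝓝 0)) (h₃c : Continuous e₃) (h₃0 : e₃ 0 = 0)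
    (h₃o : Tendsto (fun s ↦ e₃ s / s) (𝓝[>] 0) (𝓝 0)) {δ η C₀ Dz ρ : ℝ} (hδ : 0 < δ)
    (hη : 0 < η) :
    ∃ ε : ℝ, 0 < ε ∧ ε ≤ δ / 8 ∧ 2 * ε * C₀ < η ∧ 6 * ε / δ * C₀ < η ∧
      (e₁ (8 * ε) + e₃ (8 * ε)) / (2 * ρ) * Dz < η ∧
      (e₁ (8 * ε) + e₃ (8 * ε)) / (2 * ρ) * C₀ < η ∧
      (e₁ (8 * ε) + e₃ (8 * ε)) / (2 * ρ) ≤ 1 / 2 ∧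
      8 * (ψ e₁ (8 * ε) + ψ e₃ (8 * ε)) / ρ * Dz < η := by
  have hA : Tendsto (fun ε : ℝ ↦ (e₁ (8 * ε) + e₃ (8 * ε)) / (2 * ρ)) (𝓝 0) (𝓝 0) := by
    have h1 : Tendsto (fun ε : ℝ ↦ e₁ (8 * ε)) (𝓝 0) (𝓝 0) := by
      have := (h₁c.comp (continuous_const.mul continuous_id : Continuous fun ε : ℝ ↦ 8 * ε)).tendsto 0
      simpa [Function.comp_def, h₁0] using this
    have h3 : Tendsto (fun ε : ℝ ↦ e₃ (8 * ε)) (𝓝 0) (𝓝 0) := by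
      have := (h₃c.comp (continuous_const.mul continuous_id : Continuous fun ε : ℝ ↦ 8 * ε)).tendsto 0
      simpa [Function.comp_def, h₃0] using this
    simpa using (h1.add h3).div_const (2 * ρ)
  have hψc₁ := continuous_ψ h₁c h₁o
  have hψc₃ := continuous_ψ h₃c h₃o
  have hB : Tendsto (fun ε : ℝ ↦ 8 * (ψ e₁ (8 * ε) + ψ e₃ (8 * ε)) / ρ) (𝓝 0) (𝓝 0) := by
    have h1 : Tendsto (fun ε : ℝ ↦ ψ e₁ (8 * ε)) (𝓝 0) (𝓝 0) := by
      have := (hψc₁.comp (continuous_const.mul continuous_id : Continuous fun ε : ℝ ↦ 8 * ε)).tendsto 0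
      simpa [Function.comp_def, ψ_of_nonpos (le_refl (0 : ℝ))] using this
    have h3 : Tendsto (fun ε : ℝ ↦ ψ e₃ (8 * ε)) (𝓝 0) (𝓝 0) := by
      have := (hψc₃.comp (continuous_const.mul continuous_id : Continuous fun ε : ℝ ↦ 8 * ε)).tendsto 0
      simpa [Function.comp_def, ψ_of_nonpos (le_refl (0 : ℝ))] using this
    simpa using ((h1.add h3).const_mul 8).div_const ρ
  have c1 : ∀ᶠ ε in 𝓝[>] (0 : ℝ), 0 < ε := eventually_mem_nhdsWithin
  have c2 : ∀ᶠ ε in 𝓝 (0 : ℝ), ε ≤ δ / 8 := eventually_le_nhds (by positivity)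
  have c3 : ∀ᶠ ε in 𝓝 (0 : ℝ), 2 * ε * C₀ < η := by
    have : Tendsto (fun ε : ℝ ↦ 2 * ε * C₀) (𝓝 0) (𝓝 (2 * 0 * C₀)) :=
      ((continuous_const.mul continuous_id).mul continuous_const).tendsto 0
    rw [mul_zero, zero_mul] at this
    exact this.eventually (gt_mem_nhds hη)
  have c4 : ∀ᶠ ε in 𝓝 (0 : ℝ), 6 * ε / δ * C₀ < η := by
    have : Tendsto (fun ε : ℝ ↦ 6 * ε / δ * C₀) (𝓝 0) (𝓝 (6 * 0 / δ * C₀)) :=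
      (((continuous_const.mul continuous_id).div_const δ).mul continuous_const).tendsto 0
    rw [mul_zero, zero_div, zero_mul] at this
    exact this.eventually (gt_mem_nhds hη)
  have c5 : ∀ᶠ ε in 𝓝 (0 : ℝ), (e₁ (8 * ε) + e₃ (8 * ε)) / (2 * ρ) * Dz < η := by
    have := hA.mul_const Dz
    rw [zero_mul] at this
    exact this.eventually (gt_mem_nhds hη)
  have c6 : ∀ᶠ ε in 𝓝 (0 : ℝ), (e₁ (8 * ε) + e₃ (8 * ε)) / (2 * ρ) * C₀ < η := by
    have := hA.mul_const C₀
    rw [zero_mul] at this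
    exact this.eventually (gt_mem_nhds hη)
  have c7 : ∀ᶠ ε in 𝓝 (0 : ℝ), (e₁ (8 * ε) + e₃ (8 * ε)) / (2 * ρ) ≤ 1 / 2 :=
    (hA.eventually (gt_mem_nhds (by norm_num : (0 : ℝ) < 1 / 2))).mono fun _ h ↦ h.le
  have c8 : ∀ᶠ ε in 𝓝 (0 : ℝ), 8 * (ψ e₁ (8 * ε) + ψ e₃ (8 * ε)) / ρ * Dz < η := by
    have := hB.mul_const Dz
    rw [zero_mul] at this
    exact this.eventually (gt_mem_nhds hη)
  obtain ⟨ε, h1, h2, h3, h4, h5, h6, h7, h8⟩ := (c1.and (nhdsWithin_le_nhds (c2.and (c3.and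
    (c4.and (c5.and (c6.and (c7.and c8)))))))).exists
  exact ⟨ε, h1, h2, h3, h4, h5, h6, h7, h8⟩

/-! ### The corner curve inside a convex set -/

/-- **Corner curve inside a closed convex set with nonempty interior.** Let `R ⊆ F` be closed
and convex with `closedBall z ρ ⊆ R`, `O ⊆ F × F` open, `x₀, y ∈ R` with `y = x₀ + δ d`,
`δ > 0`, `dist y x₀ < r/4`, `B(x₀, r) × B(d, r/2) ⊆ O`, the segments `{x₀} × [v₁, d]` and
`{y} × [w, d]` in `O`, and suppose `v₁` is tangent to `R` at `x₀` and `-w` at `y` in the sense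
`infDist (x₀ + s v₁) R = o(s)`, `infDist (y - s w) R = o(s)` (`s → 0⁺`). Then there is a `C¹`
curve `γ : [0, L] → R` from `(x₀, v₁)` to `(y, w)` with `(γ, γ') ∈ O`: the base curve `σb`
pushed towards `z` by the factor `lamf` built from the majorants of the two defect functions
(`infDist_Hc_le`, `pushed_mem`). [folklore] -/
theorem exists_cornerCurve_convex {R : Set F} (hR : Convex ℝ R) (hRc : IsClosed R)
    {z : F} {ρ : ℝ} (hρ : 0 < ρ) (hz : closedBall z ρ ⊆ R)
    {O : Set (F × F)} (hO : IsOpen O)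
    {x₀ y v₁ w d : F} {δ r : ℝ} (hδ : 0 < δ) (hr : 0 < r) (hx₀ : x₀ ∈ R) (hyR : y ∈ R)
    (hy : y = x₀ + δ • d) (hyr : dist y x₀ < r / 4)
    (hmid : ∀ x u : F, dist x x₀ < r → dist u d < r / 2 → (x, u) ∈ O)
    (hseg₁ : ∀ θ ∈ Icc (0 : ℝ) 1, (x₀, (1 - θ) • v₁ + θ • d) ∈ O)
    (hseg₃ : ∀ θ ∈ Icc (0 : ℝ) 1, (y, (1 - θ) • w + θ • d) ∈ O)
    (he₁ : Tendsto (fun s : ℝ ↦ infDist (x₀ + s • v₁) R / s) (𝓝[>] 0) (𝓝 0))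
    (he₃ : Tendsto (fun s : ℝ ↦ infDist (y + s • (-w)) R / s) (𝓝[>] 0) (𝓝 0)) :
    ∃ (γ γ' : ℝ → F) (L : ℝ), 0 < L ∧ (∀ s, HasDerivAt γ (γ' s) s) ∧ γ 0 = x₀ ∧ γ' 0 = v₁ ∧
      γ L = y ∧ γ' L = w ∧ (∀ s ∈ Icc 0 L, (γ s, γ' s) ∈ O) ∧ ∀ s ∈ Icc 0 L, γ s ∈ R := by
  -- the two defect functions
  set e₁ : ℝ → ℝ := fun s ↦ infDist (x₀ + s • v₁) R with he₁def
  set e₃ : ℝ → ℝ := fun s ↦ infDist (y + s • (-w)) R with he₃def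
  have hne : R.Nonempty := ⟨x₀, hx₀⟩
  have he₁0 : e₁ 0 = 0 := by simp [he₁def, infDist_zero_of_mem hx₀]
  have he₃0 : e₃ 0 = 0 := by simp [he₃def, infDist_zero_of_mem hyR]
  have H₁ : ConvexOn ℝ univ e₁ ∧ e₁ 0 = 0 ∧ (∀ s, 0 ≤ e₁ s) ∧ Continuous e₁ ∧
      Tendsto (fun s ↦ e₁ s / s) (𝓝[>] 0) (𝓝 0) :=
    ⟨Literature.Analysis.Convex.convexOn_infDist_line hR hne x₀ v₁, he₁0, fun _ ↦ infDist_nonneg,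
      (continuous_infDist_pt R).comp (by fun_prop), he₁⟩
  have H₃ : ConvexOn ℝ univ e₃ ∧ e₃ 0 = 0 ∧ (∀ s, 0 ≤ e₃ s) ∧ Continuous e₃ ∧
      Tendsto (fun s ↦ e₃ s / s) (𝓝[>] 0) (𝓝 0) :=
    ⟨Literature.Analysis.Convex.convexOn_infDist_line hR hne y (-w), he₃0, fun _ ↦ infDist_nonneg,
      (continuous_infDist_pt R).comp (by fun_prop), he₃⟩
  -- the segment `[x₀, y]` lies in `R`
  have hsegx : ∀ a ∈ Icc (0 : ℝ) δ, x₀ + a • d ∈ R := by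
    intro a ha
    have heq : x₀ + a • d = (1 - a / δ) • x₀ + (a / δ) • y := by
      rw [hy, smul_add, smul_smul, div_mul_cancel₀ a hδ.ne']
      module
    rw [heq]
    exact hR hx₀ hyR (by rw [sub_nonneg, div_le_one hδ]; exact ha.2) (div_nonneg ha.1 hδ.le)
      (by ring)
  have hsegy : ∀ a ∈ Icc (0 : ℝ) δ, y + a • (-d) ∈ R := by
    intro a ha
    have heq : y + a • (-d) = x₀ + (δ - a) • d := by rw [hy]; module
    rw [heq]
    exact hsegx _ ⟨by linarith [ha.2], by linarith [ha.1]⟩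
  have hyd : δ * ‖d‖ < r / 4 := by
    rw [dist_eq_norm, hy, add_sub_cancel_left, norm_smul, Real.norm_of_nonneg hδ.le] at hyr
    exact hyr
  -- tubes about the two segments
  obtain ⟨ε₁, hε₁, hT₁⟩ := exists_tube_segment hO hseg₁
  obtain ⟨ε₃, hε₃, hT₃⟩ := exists_tube_segment hO hseg₃
  -- constants and the choice of `ε`
  obtain ⟨η, hηpos, hηε₁, hηε₃, hηr, hη1⟩ : ∃ η : ℝ, 0 < η ∧ 8 * η ≤ ε₁ ∧ 8 * η ≤ ε₃ ∧
      8 * η ≤ r ∧ 8 * η ≤ 1 := by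
    have hA : min (min ε₁ ε₃) (min r 1) ≤ ε₁ := (min_le_left _ _).trans (min_le_left _ _)
    have hB : min (min ε₁ ε₃) (min r 1) ≤ ε₃ := (min_le_left _ _).trans (min_le_right _ _)
    have hC : min (min ε₁ ε₃) (min r 1) ≤ r := (min_le_right _ _).trans (min_le_left _ _)
    have hD : min (min ε₁ ε₃) (min r 1) ≤ 1 := (min_le_right _ _).trans (min_le_right _ _)
    exact ⟨min (min ε₁ ε₃) (min r 1) / 8, by positivity, by linarith, by linarith, by linarith,
      by linarith⟩
  set C₀ : ℝ := ‖v₁‖ + ‖w‖ + ‖d‖ + 1 with hC₀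
  set Dz : ℝ := ‖z - x₀‖ + r with hDz
  obtain ⟨ε, hε, hεδ, hc3, hc4, hc5, hc6, hc7, hc8⟩ :=
    exists_small H₁.2.2.2.1 he₁0 he₁ H₃.2.2.2.1 he₃0 he₃ (C₀ := C₀) (Dz := Dz) (ρ := ρ) hδ hηpos
  -- parameters of the construction
  set T : ℝ := δ / 8 with hT
  set ℓ : ℝ := δ / 4 with hℓ
  set L : ℝ := δ + ε with hL
  have hTpos : 0 < T := by rw [hT]; positivity
  have hℓpos : 0 < ℓ := by rw [hℓ]; positivity
  have hLpos : 0 < L := by rw [hL]; positivity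
  have hm₁ : ε + T < L / 2 := by rw [hT, hL]; linarith
  have hLℓ : ε + ℓ ≤ L := by rw [hℓ, hL]; linarith
  have h98 : 9 * ε / (8 * ℓ) ≤ 1 := by rw [div_le_one (by rw [hℓ]; positivity), hℓ]; linarith
  -- the curve
  set lam := lamf e₁ e₃ ε ℓ L ρ with hlam
  set γ : ℝ → F := fun s ↦ (1 - lam s) • σb x₀ y v₁ w d ε T L s + lam s • z with hγ
  set γ' : ℝ → F := fun s ↦ (1 - lam s) • σb' v₁ w d ε T L s +
    lamf' e₁ e₃ ε ℓ L ρ s • (z - σb x₀ y v₁ w d ε T L s) with hγ'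
  have hγd : ∀ s, HasDerivAt γ (γ' s) s := fun s ↦
    hasDerivAt_push (hasDerivAt_σb hy hL hε hTpos hm₁ s)
      (hasDerivAt_lamf H₁.2.2.2.1 he₁ H₃.2.2.2.1 he₃ hε hℓpos s)
  -- bounds for `lam`
  have hlam0 : ∀ s, 0 ≤ lam s := fun s ↦ lamf_nonneg H₁ H₃ hρ s
  have hlamΛ : ∀ s ∈ Icc 0 L, lam s ≤ (e₁ (8 * ε) + e₃ (8 * ε)) / (2 * ρ) :=
    fun s hs ↦ lamf_le H₁ H₃ hρ hε hℓpos hs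
  have hlam'Λ : ∀ s ∈ Icc 0 L, |lamf' e₁ e₃ ε ℓ L ρ s| ≤ 8 * (ψ e₁ (8 * ε) + ψ e₃ (8 * ε)) / ρ :=
    fun s hs ↦ abs_lamf'_le H₁ H₃ hρ hε hℓpos h98 hs
  have hΛnn : 0 ≤ (e₁ (8 * ε) + e₃ (8 * ε)) / (2 * ρ) :=
    div_nonneg (add_nonneg (H₁.2.2.1 _) (H₃.2.2.1 _)) (by positivity)
  have hΛ'nn : 0 ≤ 8 * (ψ e₁ (8 * ε) + ψ e₃ (8 * ε)) / ρ :=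
    div_nonneg (mul_nonneg (by norm_num) (add_nonneg (ψ_nonneg H₁.2.2.1 _) (ψ_nonneg H₃.2.2.1 _)))
      hρ.le
  -- global bounds on the base curve: positions within `r` of `x₀`, speeds at most `C₀`
  have hpos : ∀ s ∈ Icc 0 L, dist (σb x₀ y v₁ w d ε T L s) x₀ < r ∧
      ‖σb' v₁ w d ε T L s‖ ≤ C₀ := fun s hs ↦
    σb_global hηpos hε hTpos hT hL hεδ hyr hyd hc3 hc4 hηr hη1 hC₀ hs
  -- deviation of the pushed curve from the base curve
  have hdev : ∀ s ∈ Icc 0 L, dist (γ s) (σb x₀ y v₁ w d ε T L s) < η ∧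
      dist (γ' s) (σb' v₁ w d ε T L s) < 2 * η := by
    intro s hs
    obtain ⟨hp, hv⟩ := hpos s hs
    have hzσ : ‖z - σb x₀ y v₁ w d ε T L s‖ ≤ Dz := by
      rw [dist_eq_norm] at hp
      have := norm_sub_le_norm_sub_add_norm_sub z x₀ (σb x₀ y v₁ w d ε T L s)
      rw [norm_sub_rev x₀] at this
      rw [hDz]; linarith
    have hl := hlamΛ s hs
    have hl' := hlam'Λ s hs
    have hl0 := hlam0 s
    constructor
    · rw [hγ, dist_push, abs_of_nonneg hl0]
      calc lam s * ‖z - σb x₀ y v₁ w d ε T L s‖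
          ≤ (e₁ (8 * ε) + e₃ (8 * ε)) / (2 * ρ) * Dz := mul_le_mul hl hzσ (norm_nonneg _) hΛnn
        _ < η := hc5
    · refine (dist_push' _ _ _ _ _).trans_lt ?_
      rw [abs_of_nonneg hl0]
      calc |lamf' e₁ e₃ ε ℓ L ρ s| * ‖z - σb x₀ y v₁ w d ε T L s‖ +
            lam s * ‖σb' v₁ w d ε T L s‖
          ≤ 8 * (ψ e₁ (8 * ε) + ψ e₃ (8 * ε)) / ρ * Dz + (e₁ (8 * ε) + e₃ (8 * ε)) / (2 * ρ) * C₀ :=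
            add_le_add (mul_le_mul hl' hzσ (norm_nonneg _) hΛ'nn)
              (mul_le_mul hl hv (norm_nonneg _) hΛnn)
        _ < 2 * η := by linarith
  -- conclusion
  refine ⟨γ, γ', L, hLpos, hγd, ?_, ?_, ?_, ?_, ?_, ?_⟩
  · simp only [hγ, hlam, lamf_zero hε hℓpos hLℓ, sub_zero, one_smul, zero_smul, add_zero]
    exact σb_zero hε hLpos.le
  · simp only [hγ', hlam, lamf_zero hε hℓpos hLℓ, lamf'_zero hε hℓpos hLℓ, sub_zero, one_smul,
      zero_smul, add_zero]
    exact σb'_zero hε hLpos.le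
  · simp only [hγ, hlam, lamf_L hε hℓpos hLℓ, sub_zero, one_smul, zero_smul, add_zero]
    exact σb_L hε hLpos
  · simp only [hγ', hlam, lamf_L hε hℓpos hLℓ, lamf'_L hε hℓpos hLℓ, sub_zero, one_smul,
      zero_smul, add_zero]
    exact σb'_L hε hLpos
  · -- membership in `O`
    intro s hs
    obtain ⟨hd1, hd2⟩ := hdev s hs
    exact pushed_mem_O hηpos hε hTpos hT hL hεδ hyr hyd hc3 hc4 hηε₁ hηε₃ hηr hC₀ hT₁ hT₃ hmid hs hd1 hd2
  · -- membership in `R`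
    intro s hs
    obtain ⟨hG1, hG3⟩ := Gm_le_lamf_mul H₁ H₃ hρ (ε := ε) (ℓ := ℓ) (L := L) s
    have hdef : infDist (σb x₀ y v₁ w d ε T L s) R ≤ (lam s * ρ) / 2 := by
      rcases le_or_gt s (L / 2) with h | h
      · rw [σb_of_le h]
        have h1 := infDist_Hc_le hR hsegx hδ hε hεδ hT hℓ H₁.1 H₁.2.2.2.1 he₁ (t := s)
          ⟨hs.1, by linarith⟩
        rw [hlam]; linarith
      · rw [σb_of_gt h]
        have h1 := infDist_Hc_le hR hsegy hδ hε hεδ hT hℓ H₃.1 H₃.2.2.2.1 he₃ (t := L - s)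
          ⟨by linarith [hs.2], by linarith⟩
        rw [hlam]; linarith
    exact pushed_mem hR hRc hρ.le hz hdef le_rfl (hlam0 s)
      ((hlamΛ s hs).trans (hc7.trans (by norm_num)))

end CornerSmoothing

/-! ## Part II. The Lorentzian manifold -/

variable {E : Type*} [NormedAddCommGroup E] [NormedSpace ℝ E] {H : Type*} [TopologicalSpace H]
  {I : ModelWithCorners ℝ E H} {n : ℕ∞ω} {M : Type*} [TopologicalSpace M] [ChartedSpace H M]
  [IsManifold I ∞ M]

namespace LorentzianMetric


variable (g : LorentzianMetric I n M) (τ : TimeOrientation g)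

/-- The **chart timecone** of `(g, τ)` at `q` of radius `r₀`: the pairs `(z, u) ∈ E × E` of a
point `z` of the chart target `r₀`-close to `φ q` (boundary points allowed) and a vector `u`
whose image `e_q⁻¹(u)` under the inverse tangent trivialization at `q` is a future-pointing
timelike vector at `φ⁻¹ z` (compare `chartCone`, which keeps interior chart points only).
[folklore] -/
def chartTimecone (q : M) (r₀ : ℝ) : Set (E × E) :=
  ((ball (extChartAt I q q) r₀ ∩ (extChartAt I q).target) ×ˢ (univ : Set E)) ∩
    (fun zu : E × E ↦ (⟨(extChartAt I q).symm zu.1,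
      (trivializationAt E (TangentSpace I) q).symmL ℝ ((extChartAt I q).symm zu.1) zu.2⟩ :
        TangentBundle I M)) ⁻¹' futureTimecone g τ

variable {g τ}

/-- Unfolding lemma for `chartTimecone`. [folklore] -/
theorem mem_chartTimecone_iff {q : M} {r₀ : ℝ} {z u : E} :
    (z, u) ∈ g.chartTimecone τ q r₀ ↔
      (z ∈ ball (extChartAt I q q) r₀ ∧ z ∈ (extChartAt I q).target) ∧
      g.val ((extChartAt I q).symm z)
          ((trivializationAt E (TangentSpace I) q).symmL ℝ ((extChartAt I q).symm z) u)
          ((trivializationAt E (TangentSpace I) q).symmL ℝ ((extChartAt I q).symm z) u) < 0 ∧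
        g.val ((extChartAt I q).symm z) (τ.vectorField ((extChartAt I q).symm z))
          ((trivializationAt E (TangentSpace I) q).symmL ℝ ((extChartAt I q).symm z) u) < 0 := by
  simp only [chartTimecone, futureTimecone, mem_inter_iff, mem_prod, mem_univ, and_true, mem_preimage,
    mem_setOf_eq]

/-- **The fibres of the chart timecone are convex** (`e_q⁻¹` is linear on fibres and timecones
are convex, `val_convexComb_lt_zero`). O'Neill 1983, Ch. 5, Lemma 5.29 ff. (p. 143).
[cite: ONeill1983, Ch. 5, Lemma 5.29 (p. 143)] -/
theorem chartTimecone_convex {q : M} {r₀ : ℝ} {z u u' : E} (hu : (z, u) ∈ g.chartTimecone τ q r₀)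
    (hu' : (z, u') ∈ g.chartTimecone τ q r₀) {θ : ℝ} (hθ : θ ∈ Icc (0 : ℝ) 1) :
    (z, (1 - θ) • u + θ • u') ∈ g.chartTimecone τ q r₀ := by
  rw [mem_chartTimecone_iff] at hu hu' ⊢
  obtain ⟨hz, hQ, hP⟩ := hu
  obtain ⟨-, hQ', hP'⟩ := hu'
  refine ⟨hz, ?_⟩
  have key := val_convexComb_lt_zero τ hQ hP hQ' hP' hθ.1 hθ.2
  rw [map_add, map_smul, map_smul]
  exact key

/-- The chart lift `(z, u) ↦ (φ⁻¹ z, e_q⁻¹(u))` into the tangent bundle is continuous on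
`target × E`. [folklore] -/
theorem continuousOn_chartLift (q : M) :
    ContinuousOn (fun zu : E × E ↦ (⟨(extChartAt I q).symm zu.1,
      (trivializationAt E (TangentSpace I) q).symmL ℝ ((extChartAt I q).symm zu.1) zu.2⟩ :
        TangentBundle I M)) ((extChartAt I q).target ×ˢ univ) := by
  set φ := extChartAt I q with hφ
  set e := trivializationAt E (TangentSpace I) q with he
  have hmaps : MapsTo (fun zu : E × E ↦ (φ.symm zu.1, zu.2)) (φ.target ×ˢ univ)
      (e.baseSet ×ˢ univ) := by
    intro zu hzu
    refine ⟨?_, mem_univ _⟩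
    rw [he, TangentBundle.trivializationAt_baseSet, ← extChartAt_source I]
    exact φ.map_target hzu.1
  have h1 : ContinuousOn (fun zu : E × E ↦ (φ.symm zu.1, zu.2)) (φ.target ×ˢ univ) :=
    ((continuousOn_extChartAt_symm q).comp continuousOn_fst (fun zu hzu ↦ hzu.1)).prodMk
      continuousOn_snd
  have h2 := e.continuousOn_symm.comp h1 hmaps
  refine h2.congr (fun zu hzu ↦ ?_)
  simp only [Function.comp_apply, TotalSpace.mk']
  rw [e.symmL_apply (hmaps hzu).1]

/-- **The chart timecone is relatively open**: there is an open `O ⊆ B(φ q, r₀) × E` which agrees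
with the chart timecone over the chart target. [folklore] -/
theorem exists_isOpen_chartTimecone (q : M) (r₀ : ℝ) :
    ∃ O : Set (E × E), IsOpen O ∧ O ⊆ ball (extChartAt I q q) r₀ ×ˢ univ ∧
      ∀ z ∈ (extChartAt I q).target, ∀ u : E,
        ((z, u) ∈ g.chartTimecone τ q r₀ ↔ (z, u) ∈ O) := by
  obtain ⟨O, hO, hOeq⟩ := (continuousOn_iff'.mp (continuousOn_chartLift (I := I) (M := M) q))
    (futureTimecone g τ) (isOpen_futureTimecone g τ)
  refine ⟨O ∩ ball (extChartAt I q q) r₀ ×ˢ univ, hO.inter (isOpen_ball.prod isOpen_univ),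
    inter_subset_right, fun z hz u ↦ ?_⟩
  have key : (z, u) ∈ (fun zu : E × E ↦ (⟨(extChartAt I q).symm zu.1,
      (trivializationAt E (TangentSpace I) q).symmL ℝ ((extChartAt I q).symm zu.1) zu.2⟩ :
        TangentBundle I M)) ⁻¹' futureTimecone g τ ∩ (extChartAt I q).target ×ˢ univ ↔
      (z, u) ∈ O ∩ (extChartAt I q).target ×ˢ univ := by rw [hOeq]
  simp only [mem_inter_iff, mem_prod, mem_univ, and_true, mem_preimage] at key
  simp only [chartTimecone, mem_inter_iff, mem_prod, mem_univ, and_true, mem_preimage, mem_ball]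
  constructor
  · rintro ⟨⟨hb, -⟩, hF⟩
    exact ⟨(key.mp ⟨hF, hz⟩).1, hb⟩
  · rintro ⟨hO', hb⟩
    exact ⟨⟨hb, hz⟩, (key.mpr ⟨hO', hz⟩).1⟩

/-- On the chart target, `d(φ⁻¹)_z` within `range I` is the inverse tangent trivialization at `q`
over `φ⁻¹ z` (Mathlib `TangentBundle.symmL_trivializationAt`). [folklore] -/
theorem mfderivWithin_extChartAt_symm_eq_symmL {q : M} {z : E}
    (hz : z ∈ (extChartAt I q).target) :
    mfderivWithin 𝓘(ℝ, E) I (extChartAt I q).symm (range I) z =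
      (trivializationAt E (TangentSpace I) q).symmL ℝ ((extChartAt I q).symm z) := by
  have hsrc : (extChartAt I q).symm z ∈ (chartAt H q).source := by
    rw [← extChartAt_source (I := I)]; exact (extChartAt I q).map_target hz
  rw [TangentBundle.symmL_trivializationAt hsrc, (extChartAt I q).right_inv hz]

/-- **A chart curve through the chart timecone lifts to a future timelike curve**, also at
boundary chart points: if `σ : ℝ → E` has derivative `u` at `s`, takes values in `range I` near
`s`, and `(σ s, u)` lies in the chart timecone, then `φ⁻¹ ∘ σ` is differentiable at `s` (chain
rule within `range I`, Mathlib `HasMFDerivWithinAt.comp`) with future-pointing timelike velocity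
`e_q⁻¹(u)`. [folklore] -/
theorem chartTimecone_velocity {q : M} {r₀ : ℝ} {σ : ℝ → E} {u : E} {s : ℝ}
    (hσ : HasDerivAt σ u s) (hR : ∀ᶠ s' in 𝓝 s, σ s' ∈ range I)
    (hK : (σ s, u) ∈ g.chartTimecone τ q r₀) :
    MDifferentiableAt 𝓘(ℝ, ℝ) I ((extChartAt I q).symm ∘ σ) s ∧
      g.IsTimelike (velocity I ((extChartAt I q).symm ∘ σ) s) ∧
      τ.IsFutureDirected (velocity I ((extChartAt I q).symm ∘ σ) s) := by
  rw [mem_chartTimecone_iff] at hK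
  obtain ⟨⟨-, hst⟩, hQ, hP⟩ := hK
  have h1 : MDifferentiableWithinAt 𝓘(ℝ, E) I (extChartAt I q).symm (range I) (σ s) :=
    mdifferentiableWithinAt_extChartAt_symm hst
  have h2 : HasMFDerivAt 𝓘(ℝ, ℝ) 𝓘(ℝ, E) σ s (ContinuousLinearMap.toSpanSingleton ℝ u) :=
    hasMFDerivAt_iff_hasFDerivAt.mpr hσ.hasFDerivAt
  have h3 : HasMFDerivWithinAt 𝓘(ℝ, ℝ) I ((extChartAt I q).symm ∘ σ) (σ ⁻¹' range I) s
      ((mfderivWithin 𝓘(ℝ, E) I (extChartAt I q).symm (range I) (σ s)).comp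
        (ContinuousLinearMap.toSpanSingleton ℝ u)) :=
    h1.hasMFDerivWithinAt.comp s h2.hasMFDerivWithinAt (mapsTo_preimage σ (range I))
  have h4 := h3.hasMFDerivAt hR
  have hvel : velocity I ((extChartAt I q).symm ∘ σ) s =
      (trivializationAt E (TangentSpace I) q).symmL ℝ ((extChartAt I q).symm (σ s)) u := by
    unfold velocity
    rw [h4.mfderiv, ← mfderivWithin_extChartAt_symm_eq_symmL hst]
    show mfderivWithin 𝓘(ℝ, E) I (extChartAt I q).symm (range I) (σ s)
      (ContinuousLinearMap.toSpanSingleton ℝ u 1) = _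
    rw [ContinuousLinearMap.toSpanSingleton_apply, one_smul]
    rfl
  have htl : g.IsTimelike (velocity I ((extChartAt I q).symm ∘ σ) s) := by
    show g.val _ (velocity I ((extChartAt I q).symm ∘ σ) s)
      (velocity I ((extChartAt I q).symm ∘ σ) s) < 0
    rw [hvel]
    exact hQ
  refine ⟨h4.mdifferentiableAt, htl, htl.isCausal, ?_⟩
  show g.val _ (τ.vectorField _) (velocity I ((extChartAt I q).symm ∘ σ) s) < 0
  rw [hvel]
  exact hP

/-- **A future timelike curve read in the chart runs through the chart timecone**: if `γ` is
differentiable at `t` with future-pointing timelike velocity and `γ t` lies in the chart domain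
of `q`, its chart image `r₀`-close to `φ q`, then `φ ∘ γ` has derivative `u = e_q(γ' t)` at `t`
(`hasDerivAt_extChartAt_comp`) and `(φ (γ t), u)` lies in the chart timecone
(`e_q⁻¹ ∘ e_q = id`). [folklore] -/
theorem chartTimecone_of_curve {q : M} {r₀ : ℝ} {γ : ℝ → M} {t : ℝ}
    (hd : MDifferentiableAt 𝓘(ℝ, ℝ) I γ t) (ht : g.IsTimelike (velocity I γ t))
    (hf : τ.IsFutureDirected (velocity I γ t)) (hsrc : γ t ∈ (chartAt H q).source)
    (hball : extChartAt I q (γ t) ∈ ball (extChartAt I q q) r₀) :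
    HasDerivAt (extChartAt I q ∘ γ)
        ((trivializationAt E (TangentSpace I) q).continuousLinearMapAt ℝ (γ t) (velocity I γ t)) t ∧
      (extChartAt I q (γ t),
        (trivializationAt E (TangentSpace I) q).continuousLinearMapAt ℝ (γ t) (velocity I γ t)) ∈
        g.chartTimecone τ q r₀ := by
  refine ⟨hasDerivAt_extChartAt_comp hd hsrc, ?_⟩
  rw [mem_chartTimecone_iff]
  have hsrc' : γ t ∈ (extChartAt I q).source := by rwa [extChartAt_source]
  refine ⟨⟨hball, (extChartAt I q).map_source hsrc'⟩, ?_⟩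
  have hleft : (extChartAt I q).symm (extChartAt I q (γ t)) = γ t :=
    (extChartAt I q).left_inv hsrc'
  have hbase : γ t ∈ (trivializationAt E (TangentSpace I) q).baseSet := by
    rw [TangentBundle.trivializationAt_baseSet]; exact hsrc
  have key : ∀ b : M, b = γ t →
      g.val b ((trivializationAt E (TangentSpace I) q).symmL ℝ b
          ((trivializationAt E (TangentSpace I) q).continuousLinearMapAt ℝ (γ t) (velocity I γ t)))
        ((trivializationAt E (TangentSpace I) q).symmL ℝ b
          ((trivializationAt E (TangentSpace I) q).continuousLinearMapAt ℝ (γ t) (velocity I γ t)))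
          < 0 ∧
      g.val b (τ.vectorField b) ((trivializationAt E (TangentSpace I) q).symmL ℝ b
          ((trivializationAt E (TangentSpace I) q).continuousLinearMapAt ℝ (γ t) (velocity I γ t)))
          < 0 := by
    rintro b rfl
    rw [Trivialization.symmL_continuousLinearMapAt _ hbase]
    exact ⟨ht, hf.2⟩
  exact key _ hleft

/-! ### Tangency of differentiable curves to the model range -/

omit [IsManifold I ∞ M] in
/-- **A differentiable curve in a set is tangent to it to first order, on both sides**: if
`c : ℝ → E` takes values in `R` and has derivative `v` at `t`, then
`infDist (c t + s v) R = o(s)` and `infDist (c t - s v) R = o(s)` as `s → 0⁺`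
(`infDist (c t ± s v) R ≤ ‖c (t ± s) - c t ∓ s v‖`). [folklore] -/
theorem tendsto_infDist_div_of_hasDerivAt {c : ℝ → E} {v : E} {t : ℝ} (hc : HasDerivAt c v t)
    {R : Set E} (hR : ∀ s, c s ∈ R) :
    Tendsto (fun s : ℝ ↦ infDist (c t + s • v) R / s) (𝓝[>] 0) (𝓝 0) ∧
      Tendsto (fun s : ℝ ↦ infDist (c t + s • (-v)) R / s) (𝓝[>] 0) (𝓝 0) := by
  have ho := (hasDerivAt_iff_isLittleO_nhds_zero.mp hc)
  -- `‖c (t + h) - c t - h • v‖ ≤ ε ‖h‖` eventually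
  have hbound : ∀ ε > 0, ∀ᶠ h in 𝓝 (0 : ℝ), ‖c (t + h) - c t - h • v‖ ≤ ε * ‖h‖ := fun ε hε ↦
    ho.def hε
  have key : ∀ (σ : ℝ), (σ = 1 ∨ σ = -1) →
      Tendsto (fun s : ℝ ↦ infDist (c t + s • (σ • v)) R / s) (𝓝[>] 0) (𝓝 0) := by
    intro σ hσ
    have hσ1 : ‖σ‖ = 1 := by rcases hσ with rfl | rfl <;> simp
    rw [Metric.tendsto_nhds]
    intro ε hε
    have h1 : ∀ᶠ s in 𝓝[>] (0 : ℝ), ‖c (t + σ * s) - c t - (σ * s) • v‖ ≤ ε / 2 * ‖σ * s‖ := by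
      have hcont : Tendsto (fun s : ℝ ↦ σ * s) (𝓝 0) (𝓝 0) := by
        simpa using (tendsto_id.const_mul σ : Tendsto (fun s : ℝ ↦ σ * s) (𝓝 0) (𝓝 (σ * 0)))
      exact nhdsWithin_le_nhds (hcont.eventually (hbound (ε / 2) (by positivity)))
    filter_upwards [h1, self_mem_nhdsWithin] with s h1 hs
    have hs' : 0 < s := hs
    have hle : infDist (c t + s • (σ • v)) R ≤ ε / 2 * s := by
      calc infDist (c t + s • (σ • v)) R ≤ dist (c t + s • (σ • v)) (c (t + σ * s)) :=
            infDist_le_dist_of_mem (hR _)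
        _ = ‖c (t + σ * s) - c t - (σ * s) • v‖ := by
            rw [dist_comm, dist_eq_norm, smul_smul, mul_comm s σ, sub_sub]
        _ ≤ ε / 2 * ‖σ * s‖ := h1
        _ = ε / 2 * s := by rw [norm_mul, hσ1, one_mul, Real.norm_of_nonneg hs'.le]
    rw [Real.dist_eq, sub_zero, abs_of_nonneg (div_nonneg infDist_nonneg hs'.le),
      div_lt_iff₀ hs']
    have h2 : ε / 2 * s < ε * s := by nlinarith
    linarith
  constructor
  · simpa using key 1 (Or.inl rfl)
  · simpa using key (-1) (Or.inr rfl)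


/-! ### Transfer of the timelike condition along a germ -/

/-- If two curves agree near `t` and one is differentiable at `t` with future-directed timelike
velocity, so is the other (the velocity is a germ invariant, Mathlib
`Filter.EventuallyEq.mfderiv_eq`). [folklore] -/
theorem timelike_of_eventuallyEq {γ γ' : ℝ → M} {t : ℝ} (h : γ =ᶠ[𝓝 t] γ')
    (hd : MDifferentiableAt 𝓘(ℝ, ℝ) I γ' t) (ht : g.IsTimelike (velocity I γ' t))
    (hf : τ.IsFutureDirected (velocity I γ' t)) :
    MDifferentiableAt 𝓘(ℝ, ℝ) I γ t ∧ g.IsTimelike (velocity I γ t) ∧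
      τ.IsFutureDirected (velocity I γ t) := by
  have hpt : γ t = γ' t := h.eq_of_nhds
  have hvel : velocity I γ t = velocity I γ' t := by
    unfold velocity
    rw [h.mfderiv_eq]
    rfl
  have key : ∀ b : M, b = γ' t → ∀ V : TangentSpace I b, V = velocity I γ' t →
      g.IsTimelike V ∧ τ.IsFutureDirected V := by
    rintro b rfl V rfl
    exact ⟨ht, hf⟩
  exact ⟨hd.congr_of_eventuallyEq h, key _ hpt _ hvel⟩

/-! ### Transitivity of `≪` -/

/-- **Corner smoothing, local form** (the construction of `exists_isFutureTimelikeCurveOn_trans`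
below, with its gluing data exported): under the hypotheses of
`exists_isFutureTimelikeCurveOn_trans` and for any `T > a₂`, there is a future timelike curve
`γ : [a₁, b₂ - c] → M` from `p` to `r` which *is `γ₁` on `(-∞, b₁]`* and *is the translate
`γ₂ (· + c)` on `(b₁ + L, ∞)`*, where `L > 0` is the parameter length of the rounded corner and
the junction parameter `t₂ = b₁ + L + c ∈ (a₂, b₂)` of `γ₂` is moreover `< T` (the caller
controls how short the modified initial stretch of `γ₂` is). Construction, proof and source as
in the docstring of `exists_isFutureTimelikeCurveOn_trans`, which is re-derived from this
statement. [cite: ONeill1983, Ch. 14, p. 402] -/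
theorem exists_isFutureTimelikeCurveOn_trans_local {p q r : M}
    {γ₁ : ℝ → M} {a₁ b₁ : ℝ} (hab₁ : a₁ < b₁) (hγ₁ : g.IsFutureTimelikeCurveOn τ γ₁ (Icc a₁ b₁))
    (hγ₁a : γ₁ a₁ = p) (hγ₁b : γ₁ b₁ = q)
    {γ₂ : ℝ → M} {a₂ b₂ : ℝ} (hab₂ : a₂ < b₂) (hγ₂ : g.IsFutureTimelikeCurveOn τ γ₂ (Icc a₂ b₂))
    (hγ₂a : γ₂ a₂ = q) (hγ₂b : γ₂ b₂ = r) (T : ℝ) (hT : a₂ < T) :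
    ∃ (γ : ℝ → M) (L c t₂ : ℝ), 0 < L ∧ t₂ ∈ Ioo a₂ b₂ ∧ t₂ < T ∧ b₁ + L + c = t₂ ∧
      g.IsFutureTimelikeCurveOn τ γ (Icc a₁ (b₂ - c)) ∧ γ a₁ = p ∧ γ (b₂ - c) = r ∧
      (∀ t ≤ b₁, γ t = γ₁ t) ∧ (∀ t, b₁ + L < t → γ t = γ₂ (t + c)) := by
  -- Step 0: a chart ball with `ball ∩ range I ⊆ target`, and the open set `O`
  obtain ⟨U, hU, hUt⟩ := mem_nhdsWithin_iff_exists_mem_nhds_inter.mp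
    (extChartAt_target_mem_nhdsWithin (I := I) q)
  obtain ⟨r₀, hr₀pos, hr₀U⟩ := Metric.mem_nhds_iff.mp hU
  have hr₀ : ball (extChartAt I q q) r₀ ∩ range I ⊆ (extChartAt I q).target :=
    fun x hx ↦ hUt ⟨hr₀U hx.1, hx.2⟩
  obtain ⟨O, hO, hOball, hOK⟩ := exists_isOpen_chartTimecone (g := g) (τ := τ) q r₀
  have hKO : ∀ z ∈ range I, ∀ u : E, ((z, u) ∈ g.chartTimecone τ q r₀ ↔ (z, u) ∈ O) := by
    intro z hz u
    by_cases hb : z ∈ ball (extChartAt I q q) r₀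
    · exact hOK z (hr₀ ⟨hb, hz⟩) u
    · constructor
      · intro h; exact absurd (mem_chartTimecone_iff.mp h).1.1 hb
      · intro h; exact absurd (hOball h).1 hb
  -- Step 1: the chart velocities `v₁` of `γ₁` at `b₁` and `d₀` of `γ₂` at `a₂`
  have hq₁ : γ₁ b₁ ∈ (chartAt H q).source := by rw [hγ₁b]; exact mem_chart_source H q
  have hq₂ : γ₂ a₂ ∈ (chartAt H q).source := by rw [hγ₂a]; exact mem_chart_source H q
  have hx₁ : extChartAt I q (γ₁ b₁) = extChartAt I q q := by rw [hγ₁b]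
  have hx₂ : extChartAt I q (γ₂ a₂) = extChartAt I q q := by rw [hγ₂a]
  have hb₁ball : extChartAt I q (γ₁ b₁) ∈ ball (extChartAt I q q) r₀ := by
    rw [hx₁]; exact mem_ball_self hr₀pos
  have ha₂ball : extChartAt I q (γ₂ a₂) ∈ ball (extChartAt I q q) r₀ := by
    rw [hx₂]; exact mem_ball_self hr₀pos
  obtain ⟨hd₁, ht₁, hf₁⟩ := hγ₁ b₁ ⟨hab₁.le, le_rfl⟩
  obtain ⟨hd₂, ht₂, hf₂⟩ := hγ₂ a₂ ⟨le_rfl, hab₂.le⟩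
  obtain ⟨hc₁, hv₁K⟩ := chartTimecone_of_curve hd₁ ht₁ hf₁ hq₁ hb₁ball
  obtain ⟨hc₂, hd₀K⟩ := chartTimecone_of_curve hd₂ ht₂ hf₂ hq₂ ha₂ball
  rw [hx₁] at hv₁K
  rw [hx₂] at hd₀K
  set x₀ : E := extChartAt I q q with hx₀
  set v₁ : E := (trivializationAt E (TangentSpace I) q).continuousLinearMapAt ℝ (γ₁ b₁)
    (velocity I γ₁ b₁) with hv₁
  set d₀ : E := (trivializationAt E (TangentSpace I) q).continuousLinearMapAt ℝ (γ₂ a₂)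
    (velocity I γ₂ a₂) with hd₀
  have hx₀R : x₀ ∈ range I := by rw [hx₀, extChartAt_coe]; exact mem_range_self _
  have hd₀O : (x₀, d₀) ∈ O := (hKO x₀ hx₀R d₀).mp hd₀K
  -- Step 2: a product ball about `(x₀, d₀)` inside `O`
  obtain ⟨r, hrpos, hrO⟩ := Metric.isOpen_iff.mp hO (x₀, d₀) hd₀O
  have hrO' : ∀ x u : E, dist x x₀ < r → dist u d₀ < r → (x, u) ∈ O :=
    fun x u hx hu ↦ hrO (by rw [mem_ball, Prod.dist_eq]; exact max_lt hx hu)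
  -- Step 3: the parameter `t₂ ∈ (a₂, b₂)`, `t₂ < T`
  have hF : ∀ᶠ t in 𝓝[>] a₂, γ₂ t ∈ (extChartAt I q).source ∧
      dist ((extChartAt I q ∘ γ₂) t) x₀ < r / 4 ∧
      dist (slope (extChartAt I q ∘ γ₂) a₂ t) d₀ < r / 4 ∧ t ∈ Ioo a₂ b₂ ∧ t < T := by
    have h1 : ∀ᶠ t in 𝓝 a₂, γ₂ t ∈ (extChartAt I q).source :=
      hd₂.continuousAt.eventually_mem ((isOpen_extChartAt_source q).mem_nhds
        (by rwa [extChartAt_source]))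
    have h2 : ∀ᶠ t in 𝓝 a₂, dist ((extChartAt I q ∘ γ₂) t) x₀ < r / 4 := by
      have h := Metric.tendsto_nhds.mp hc₂.continuousAt (r / 4) (by positivity)
      refine h.mono fun t ht ↦ ?_
      rwa [show (extChartAt I q ∘ γ₂) a₂ = x₀ from hx₂] at ht
    have h3 : ∀ᶠ t in 𝓝[>] a₂, dist (slope (extChartAt I q ∘ γ₂) a₂ t) d₀ < r / 4 :=
      Metric.tendsto_nhds.mp (hc₂.tendsto_slope.mono_left (nhdsGT_le_nhdsNE a₂)) _
        (by positivity)
    have h4 : ∀ᶠ t in 𝓝[>] a₂, t ∈ Ioo a₂ b₂ := Ioo_mem_nhdsGT hab₂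
    have h5 : ∀ᶠ t in 𝓝[>] a₂, t ∈ Ioo a₂ T := Ioo_mem_nhdsGT hT
    filter_upwards [nhdsWithin_le_nhds h1, nhdsWithin_le_nhds h2, h3, h4, h5]
      with t h1 h2 h3 h4 h5
    exact ⟨h1, h2, h3, h4, h5.2⟩
  obtain ⟨t₂, hsrc₂, hdist₂, hslope₂, ht₂, ht₂T⟩ := hF.exists
  have hsrc₂' : γ₂ t₂ ∈ (chartAt H q).source := by rwa [← extChartAt_source (I := I)]
  set δ : ℝ := t₂ - a₂ with hδ
  have hδpos : 0 < δ := sub_pos.mpr ht₂.1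
  set y : E := (extChartAt I q ∘ γ₂) t₂ with hy
  set d : E := slope (extChartAt I q ∘ γ₂) a₂ t₂ with hd
  have hyd : y = x₀ + δ • d := by
    rw [hd, slope_def_module, show (extChartAt I q ∘ γ₂) a₂ = x₀ from hx₂, ← hδ, smul_smul,
      mul_inv_cancel₀ hδpos.ne', one_smul, add_sub_cancel]
  have hyR : y ∈ range I := by rw [hy, Function.comp_apply, extChartAt_coe]; exact mem_range_self _
  have hmid : ∀ x u : E, dist x x₀ < r → dist u d < r / 2 → (x, u) ∈ O :=
    fun x u hx hu ↦ hrO' x u hx (by linarith [dist_triangle u d d₀])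
  have hydO : (y, d) ∈ O := hmid y d (by linarith) (by simp; positivity)
  have hydK : (y, d) ∈ g.chartTimecone τ q r₀ := (hKO y hyR d).mpr hydO
  -- Step 4: the chart velocity `w` of `γ₂` at `t₂`
  obtain ⟨hd₃, ht₃, hf₃⟩ := hγ₂ t₂ ⟨ht₂.1.le, ht₂.2.le⟩
  obtain ⟨hc₃, hwK⟩ := chartTimecone_of_curve hd₃ ht₃ hf₃ hsrc₂' (mem_chartTimecone_iff.mp hydK).1.1
  set w : E := (trivializationAt E (TangentSpace I) q).continuousLinearMapAt ℝ (γ₂ t₂)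
    (velocity I γ₂ t₂) with hw
  have hwK' : (y, w) ∈ g.chartTimecone τ q r₀ := hwK
  -- Step 5: the two segments lie in `O`
  have hx₀dK : (x₀, d) ∈ g.chartTimecone τ q r₀ :=
    (hKO x₀ hx₀R d).mpr (hmid x₀ d (by simp [hrpos]) (by simp; positivity))
  have hseg₁ : ∀ θ ∈ Icc (0 : ℝ) 1, (x₀, (1 - θ) • v₁ + θ • d) ∈ O :=
    fun θ hθ ↦ (hKO x₀ hx₀R _).mp (chartTimecone_convex hv₁K hx₀dK hθ)
  have hseg₃ : ∀ θ ∈ Icc (0 : ℝ) 1, (y, (1 - θ) • w + θ • d) ∈ O :=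
    fun θ hθ ↦ (hKO y hyR _).mp (chartTimecone_convex hwK' hydK hθ)
  -- Step 6: tangency of the chart curves to `range I`
  have hR₁ : ∀ s, (extChartAt I q ∘ γ₁) s ∈ range I := fun s ↦ by
    rw [Function.comp_apply, extChartAt_coe]; exact mem_range_self _
  have hR₂ : ∀ s, (extChartAt I q ∘ γ₂) s ∈ range I := fun s ↦ by
    rw [Function.comp_apply, extChartAt_coe]; exact mem_range_self _
  have he₁ := (tendsto_infDist_div_of_hasDerivAt hc₁ hR₁).1
  rw [show (extChartAt I q ∘ γ₁) b₁ = x₀ from hx₁] at he₁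
  have he₃ := (tendsto_infDist_div_of_hasDerivAt hc₃ hR₂).2
  -- Step 7: an interior ball of `range I`
  obtain ⟨z, hz⟩ := I.nonempty_interior
  obtain ⟨ρ', hρ'pos, hρ'⟩ := Metric.mem_nhds_iff.mp (mem_interior_iff_mem_nhds.mp hz)
  have hzρ : closedBall z (ρ' / 2) ⊆ range I :=
    (closedBall_subset_ball (by linarith)).trans hρ'
  -- Step 8: the corner curve in the chart
  obtain ⟨σ, σ', L, hL, hσd, hσ0, hσ'0, hσL, hσ'L, hσO, hσR⟩ :=
    CornerSmoothing.exists_cornerCurve_convex I.convex_range I.isClosed_range (half_pos hρ'pos)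
      hzρ hO hδpos hrpos hx₀R hyR hyd hdist₂ hmid hseg₁ hseg₃ he₁ he₃
  have hσK : ∀ s ∈ Icc 0 L, (σ s, σ' s) ∈ g.chartTimecone τ q r₀ :=
    fun s hs ↦ (hKO _ (hσR s hs) _).mpr (hσO s hs)
  -- Step 9: the glued curve `Γ` and its chart representation `C` near `[b₁, b₁ + L]`
  set c : ℝ := t₂ - (b₁ + L) with hc
  have hc' : b₁ + L + c = t₂ := by rw [hc]; ring
  set Γ : ℝ → M := fun t ↦ if t ≤ b₁ then γ₁ t else
    if t ≤ b₁ + L then (extChartAt I q).symm (σ (t - b₁)) else γ₂ (t + c) with hΓ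
  set C : ℝ → E := fun t ↦ if t ≤ b₁ then extChartAt I q (γ₁ t) else
    if t ≤ b₁ + L then σ (t - b₁) else extChartAt I q (γ₂ (t + c)) with hC
  have hCσ : ∀ s ∈ Icc b₁ (b₁ + L), C s = σ (s - b₁) := by
    intro s hs
    rcases hs.1.eq_or_lt with rfl | hlt
    · simp only [hC, le_refl, if_true, sub_self, hσ0]
      exact hx₁
    · simp only [hC, not_le.mpr hlt, if_false, hs.2, if_true]
  have hCrange : ∀ s, C s ∈ range I := by
    intro s
    by_cases h1 : s ≤ b₁
    · simp only [hC, h1, if_true]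
      exact hR₁ s
    · by_cases h2 : s ≤ b₁ + L
      · rw [hCσ s ⟨(not_le.mp h1).le, h2⟩]
        exact hσR (s - b₁) ⟨by linarith [not_le.mp h1], by linarith⟩
      · simp only [hC, h1, h2, if_false]
        exact hR₂ (s + c)
  have hE₁ : ∀ᶠ s in 𝓝 b₁, γ₁ s ∈ (extChartAt I q).source :=
    hd₁.continuousAt.eventually_mem ((isOpen_extChartAt_source q).mem_nhds
      (by rwa [extChartAt_source]))
  have hE₂ : ∀ᶠ s in 𝓝 (b₁ + L), γ₂ (s + c) ∈ (extChartAt I q).source := by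
    have h1 : ContinuousAt (fun s ↦ γ₂ (s + c)) (b₁ + L) := by
      have h := hd₃.continuousAt
      have h2 : ContinuousAt (fun s : ℝ ↦ s + c) (b₁ + L) :=
        Continuous.continuousAt (by fun_prop)
      rw [← hc'] at h
      exact ContinuousAt.comp' (g := γ₂) (f := fun s : ℝ ↦ s + c) h h2
    refine h1.eventually_mem ((isOpen_extChartAt_source q).mem_nhds ?_)
    rw [hc']; exact hsrc₂
  obtain ⟨η₁, hη₁, hη₁'⟩ := Metric.eventually_nhds_iff.mp hE₁
  obtain ⟨η₂, hη₂, hη₂'⟩ := Metric.eventually_nhds_iff.mp hE₂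
  have hΓC : ∀ s ∈ Ioo (b₁ - η₁) (b₁ + L + η₂), Γ s = (extChartAt I q).symm (C s) := by
    intro s hs
    by_cases h1 : s ≤ b₁
    · have hs₁ : γ₁ s ∈ (extChartAt I q).source := by
        refine hη₁' ?_
        rw [Real.dist_eq, abs_sub_lt_iff]
        constructor <;> linarith [hs.1]
      simp only [hΓ, hC, h1, if_true]
      exact ((extChartAt I q).left_inv hs₁).symm
    · by_cases h2 : s ≤ b₁ + L
      · simp only [hΓ, hC, h1, h2, if_false, if_true]
      · have hs₂ : γ₂ (s + c) ∈ (extChartAt I q).source := by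
          refine hη₂' ?_
          rw [Real.dist_eq, abs_sub_lt_iff]
          constructor <;> linarith [hs.2, not_le.mp h2]
        simp only [hΓ, hC, h1, h2, if_false]
        exact ((extChartAt I q).left_inv hs₂).symm
  have hshift : ∀ s, HasDerivAt (fun s ↦ σ (s - b₁)) (σ' (s - b₁)) s :=
    fun s ↦ HasDerivAt.comp_sub_const s b₁ (hσd (s - b₁))
  have hCd : ∀ t ∈ Icc b₁ (b₁ + L), HasDerivAt C (σ' (t - b₁)) t := by
    intro t ht
    rcases ht.1.eq_or_lt with rfl | hgt
    · refine CornerSmoothing.hasDerivAt_of_Iic_Ici' ?_ ?_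
      · rw [sub_self, hσ'0]
        exact hc₁.hasDerivWithinAt.congr (fun s hs ↦ by simp [hC, show s ≤ b₁ from hs])
          (by simp [hC])
      · refine (hshift b₁).hasDerivWithinAt.congr_of_eventuallyEq ?_ (hCσ b₁ ⟨le_rfl, by linarith⟩)
        filter_upwards [Icc_mem_nhdsGE (show b₁ < b₁ + L by linarith)] with s hs using hCσ s hs
    · rcases ht.2.eq_or_lt with rfl | hlt
      · refine CornerSmoothing.hasDerivAt_of_Iic_Ici' ?_ ?_
        · refine (hshift (b₁ + L)).hasDerivWithinAt.congr_of_eventuallyEq ?_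
            (hCσ _ ⟨by linarith, le_rfl⟩)
          filter_upwards [Icc_mem_nhdsLE (show b₁ < b₁ + L by linarith)] with s hs using hCσ s hs
        · have h3 : HasDerivAt (fun s ↦ (extChartAt I q ∘ γ₂) (s + c)) w (b₁ + L) := by
            refine HasDerivAt.comp_add_const (b₁ + L) c ?_
            rw [hc']; exact hc₃
          rw [show σ' (b₁ + L - b₁) = w by rw [add_sub_cancel_left, hσ'L]]
          have hpt : C (b₁ + L) = (extChartAt I q ∘ γ₂) (b₁ + L + c) := by
            rw [hCσ _ ⟨by linarith, le_rfl⟩, add_sub_cancel_left, hσL, hy, hc']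
          refine h3.hasDerivWithinAt.congr_of_eventuallyEq ?_ hpt
          filter_upwards [self_mem_nhdsWithin] with s hs
          rcases (show b₁ + L ≤ s from hs).eq_or_lt with rfl | hlt
          · exact hpt
          · have h1 : ¬ s ≤ b₁ := not_le.mpr (by linarith)
            simp only [hC, h1, not_le.mpr hlt, if_false, Function.comp_apply]
      · refine (hshift t).congr_of_eventuallyEq ?_
        filter_upwards [Ioo_mem_nhds hgt hlt] with s hs using hCσ s ⟨hs.1.le, hs.2.le⟩
  have hγ₂c : g.IsFutureTimelikeCurveOn τ (γ₂ ∘ fun u ↦ u + c) ((fun u ↦ u + c) ⁻¹' Icc a₂ b₂) :=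
    hγ₂.comp_of_hasDerivAt (φ := fun u ↦ u + c) (φ' := fun _ ↦ 1)
      (fun u ↦ (hasDerivAt_id' u).add_const c) (fun _ ↦ one_pos)
  -- Step 10: conclusion
  have hb' : b₁ + L < b₂ - c := by rw [hc]; linarith [ht₂.2]
  refine ⟨Γ, L, c, t₂, hL, ht₂, ht₂T, hc', ?_, ?_, ?_, fun t ht ↦ ?_, fun t ht ↦ ?_⟩
  · intro t ht
    rcases lt_or_ge t b₁ with htb | htb
    · have hev : Γ =ᶠ[𝓝 t] γ₁ := by
        filter_upwards [Iio_mem_nhds htb] with s hs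
        simp only [hΓ, (show s < b₁ from hs).le, if_true]
      obtain ⟨hd, htl, hfd⟩ := hγ₁ t ⟨ht.1, htb.le⟩
      exact timelike_of_eventuallyEq hev hd htl hfd
    rcases le_or_gt t (b₁ + L) with htL | htL
    · have ht' : t - b₁ ∈ Icc 0 L := ⟨sub_nonneg.mpr htb, by linarith⟩
      have hev : Γ =ᶠ[𝓝 t] (extChartAt I q).symm ∘ C := by
        filter_upwards [Ioo_mem_nhds (show b₁ - η₁ < t by linarith) (show t < b₁ + L + η₂ by
          linarith)] with s hs using hΓC s hs
      have hKt : (C t, σ' (t - b₁)) ∈ g.chartTimecone τ q r₀ := by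
        rw [hCσ t ⟨htb, htL⟩]; exact hσK _ ht'
      obtain ⟨hmd, htl, hfd⟩ :=
        chartTimecone_velocity (hCd t ⟨htb, htL⟩) (Eventually.of_forall hCrange) hKt
      exact timelike_of_eventuallyEq hev hmd htl hfd
    · have htc : t + c ∈ Icc a₂ b₂ := ⟨by linarith [ht₂.1], by linarith [ht.2]⟩
      obtain ⟨hd, htl, hfd⟩ := hγ₂c t htc
      have hev : Γ =ᶠ[𝓝 t] (γ₂ ∘ fun u ↦ u + c) := by
        filter_upwards [Ioi_mem_nhds htL] with s hs
        have h1 : ¬ s ≤ b₁ := not_le.mpr (by linarith [show b₁ + L < s from hs])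
        simp only [hΓ, h1, not_le.mpr (show b₁ + L < s from hs), if_false, Function.comp_apply]
      exact timelike_of_eventuallyEq hev hd htl hfd
  · simp only [hΓ, hab₁.le, if_true]
    exact hγ₁a
  · have h1 : ¬ b₂ - c ≤ b₁ := not_le.mpr (by linarith)
    have h2 : ¬ b₂ - c ≤ b₁ + L := not_le.mpr hb'
    simp only [hΓ, h1, h2, if_false, sub_add_cancel]
    exact hγ₂b
  · simp only [hΓ, ht, if_true]
  · have h1 : ¬ t ≤ b₁ := not_le.mpr (by linarith)
    simp only [hΓ, h1, not_le.mpr ht, if_false]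

/-- **Corner smoothing: `p ≪ q` and `q ≪ r` imply `p ≪ r`**, at every junction point `q`, also
on the boundary or at a corner of the manifold. Given future timelike curves
`γ₁ : [a₁, b₁] → M` from `p` to `q` and `γ₂ : [a₂, b₂] → M` from `q` to `r` (differentiable at
every parameter, as maps `ℝ → M`), there is a future timelike curve from `p` to `r`. In the
extended chart `φ` at `q` (`x₀ = φ q`, `R = range I` closed convex with nonempty interior): let
`O ⊆ E × E` be open and agree over the chart target with the chart timecone
(`exists_isOpen_chartTimecone`); `v₁ = e_q(γ₁'(b₁))`; `t₂ > a₂` so close to `a₂` that `γ₂ t₂`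
is in the chart, `y = φ(γ₂ t₂)` is `r/4`-close to `x₀` and the chord `d = (y - x₀)/(t₂ - a₂)` is
`r/4`-close to `e_q(γ₂'(a₂))`; `w = e_q(γ₂'(t₂))`. Both `φ ∘ γ₁` and `φ ∘ γ₂` take values in `R`
and are differentiable at `b₁`, `t₂` as maps on `ℝ`, hence tangent to `R` to first order on both
sides (`tendsto_infDist_div_of_hasDerivAt`); so `CornerSmoothing.exists_cornerCurve_convex`
yields a `C¹` chart curve `σ : [0, L] → R` from `(x₀, v₁)` to `(y, w)` through `O`. The curve is
`γ₁` on `(-∞, b₁]`, `φ⁻¹ ∘ σ(· - b₁)` on `[b₁, b₁ + L]`, `γ₂(· + c)` after; near `[b₁, b₁ + L]`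
it is `φ⁻¹` of a chart curve glued from `φ ∘ γ₁`, `σ`, `φ ∘ γ₂`, differentiable at the two
junctions by one-sided gluing, with future timelike velocity by `chartTimecone_velocity` (chain
rule within `range I`); elsewhere it agrees locally with `γ₁` or a translate of `γ₂`.
O'Neill 1983, Ch. 14, p. 402 ("The relations defined above are transitive"); for O'Neill's
piecewise smooth curves this is juxtaposition, the rounding of the corner being what the
everywhere-differentiable curve class requires. [cite: ONeill1983, Ch. 14, p. 402] -/
theorem exists_isFutureTimelikeCurveOn_trans {p q r : M}
    {γ₁ : ℝ → M} {a₁ b₁ : ℝ} (hab₁ : a₁ < b₁) (hγ₁ : g.IsFutureTimelikeCurveOn τ γ₁ (Icc a₁ b₁))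
    (hγ₁a : γ₁ a₁ = p) (hγ₁b : γ₁ b₁ = q)
    {γ₂ : ℝ → M} {a₂ b₂ : ℝ} (hab₂ : a₂ < b₂) (hγ₂ : g.IsFutureTimelikeCurveOn τ γ₂ (Icc a₂ b₂))
    (hγ₂a : γ₂ a₂ = q) (hγ₂b : γ₂ b₂ = r) :
    ∃ (γ : ℝ → M) (a b : ℝ), a < b ∧ g.IsFutureTimelikeCurveOn τ γ (Icc a b) ∧
      γ a = p ∧ γ b = r := by
  obtain ⟨γ, L, c, t₂, hL, ht₂, -, hc, hγ, hγa, hγb, -, -⟩ :=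
    exists_isFutureTimelikeCurveOn_trans_local hab₁ hγ₁ hγ₁a hγ₁b hab₂ hγ₂ hγ₂a hγ₂b b₂ hab₂
  exact ⟨γ, a₁, b₂ - c, by linarith [ht₂.2], hγ, hγa, hγb⟩

/-- **Transitivity at the level of chronological futures**: if `q ∈ I⁺(S)` and `r ∈ I⁺(q)` then
`r ∈ I⁺(S)`. O'Neill 1983, Ch. 14, p. 402. [cite: ONeill1983, Ch. 14, p. 402] -/
theorem mem_chronologicalFuture_trans {S : Set M} {q r : M}
    (hqS : q ∈ g.chronologicalFuture τ S) (hr : r ∈ g.chronologicalFuture τ {q}) :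
    r ∈ g.chronologicalFuture τ S := by
  obtain ⟨p, hp, γ₁, a₁, b₁, hab₁, hγ₁, hpa, hqb⟩ := hqS
  obtain ⟨q', rfl : q' = q, γ₂, a₂, b₂, hab₂, hγ₂, hqa, hrb⟩ := hr
  obtain ⟨γ, a, b, hab, hγ, ha, hb⟩ :=
    exists_isFutureTimelikeCurveOn_trans hab₁ hγ₁ hpa hqb hab₂ hγ₂ hqa hrb
  exact ⟨p, hp, γ, a, b, hab, hγ, ha, hb⟩

variable (g τ) in
/-- **Discharge of `chronologicalFuture_chronologicalFuture_subset`**: transitivity of the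
chronological relation, `I⁺(I⁺(S)) ⊆ I⁺(S)`, i.e. `p ≪ q ≪ r ⟹ p ≪ r`, for every time-oriented
Lorentzian metric (of any regularity `C^n`; the bound `2 ≤ n` of the fact is not used) on every
manifold — with boundary and corners, over any real normed model space, without Hausdorff,
second countability or completeness hypotheses (`mem_chronologicalFuture_trans`). O'Neill 1983,
Ch. 14, p. 402 ("The relations defined above are transitive") and the display
`I⁺(A) = I⁺(I⁺A)` on p. 403, of which the fact records the inclusion `⊇`.
[cite: ONeill1983, Ch. 14, pp. 402–403] -/
theorem chronologicalFuture_chronologicalFuture_subset_holds :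
    g.chronologicalFuture_chronologicalFuture_subset τ := by
  intro _ S r ⟨q, hq, hr⟩
  exact mem_chronologicalFuture_trans hq ⟨q, rfl, hr⟩


end LorentzianMetric

end Literature.Geometry.Lorentzian

end
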